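import Literature.MathematicalPhysics.QuantumFieldTheory.Balaban1983to89.B16RLeafRecord12AtLive
import Literature.MathematicalPhysics.QuantumFieldTheory.Balaban1983to89.Node00.Record13

/-!
# `Balaban1983to89.B16RLeafRecord13Live` — YM-DAG nodes N13∕N11 AT NODE 00's STAGE-13 RECORD on the live-selector line: the 𝐑-leaf of record from the
# provisos ALONE, (S1ᵀ) needed only at the LIVE sequences, Theorem 1 and the node, «𝐑 of record = identity a.e.» — keyed on `Node00.Record13` only
# ([Balaban1988Convergent] p. 244, Thm 1 p. 262; [Balaban1989LargeFieldI] (0.3)–(0.4) p. 176, (i)–(ii) p. 177; [Balaban1989LargeFieldII] Thm 1 p. 355)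

statement-level bookkeeping over published theorems with citation tags; kernel-checked compositions of tree theorems;
nothing here is a claim about the Yang–Mills mass gap.

Cell `pub-ymgap` (HUMAN RULING D-0062, Track A), seat `pub-ymgap-dag-n11-e` (R134 fan-out row N11∕s3 «`ThmP245Printed` :375 via `rOperation` from N13's `ROpLeaf`
(pairs with n13-c)»), generation 5 — trigger: node00-def-T's `Node00/Record13.lean` (p486037; v1.1 with `Provisos₁₃.bg := BgProvisoΛ …`, letter `ε₂₉`) LANDED.
[III] = [Balaban1988Convergent], [IV] = [Balaban1989LargeFieldI], [B16] = [Balaban1989LargeFieldII].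

WHAT THIS FILE IS.  The ₁₃ twin of this seat's `…B16RLeafRecord12Live` (p477150 ∕ p479829) and `…B16RLeafRecord12AtLive` (p480538 ∕ p483465) — the SAME
mathematics re-keyed `₁₂ ↦ ₁₃` at the Stage-13 plugs `EOfRecord₁₃ θ`, `gOfRecord₁₃ θ p` (the β RE-POINT along `TcanOfRecord` and the (2.9) species changes the
histories, so the ₁₂ theorems do not transfer by name) and at the record's `rstep` proviso IN THE INTEGRABLE FORM `RepData.ProvisosInt` (a.e. support clause; the ₁₂
files read the support form) — with ONE interface decision: every theorem is stated at an ARBITRARY `θ : Stage13Params F N` and the live-selector line enters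
through node00-def-T's §4c SELECTOR CLAUSE `hsel : θ.ppSel = ppSelLiveOfRecord F N θ.ν θ.τ9 (EOfRecord₁₃ F N θ) (wOfRecord₉ F N θ.toStage9Params)` DISPLAYED
(`Record13` :603's binder shape), which node00-def-K0a's re-pin `θ.liveRepin₁₃` and witness `theta13LiveOfRecord` satisfy by `rfl` — so this file imports NO
K0a Stage-13 module and lands independently of its filing order (the `rfl` instantiations are a ten-line sequel).

CONTENT, BY SECTION (every ₁₂ name has its ₁₃ twin; generic lemmas of the ₁₂ files — `rstepSlotOfRecord_of_fix_of_dead`, `rstepOfSel_TexpA_eq_zero_of_dead_of_idem`,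
`ppSelLiveOfRecord_succ_idem`, `dead_of_ppSelLiveOfRecord_succ_ne`, `not_mem_range_of_idem_of_ne`, `fibreIntegral_rterm_eq_zero_of_not_live`, `solveCoupling_nonneg` —
are imported BY NAME, never restated):
* §0 the sign `0 ≤ g_{k+1}` is FREE along every ₁₃ history (`gOfRecord₁₃_succ_nonneg`: the (0.20) forward solution is `1∕√y` or `0`) — no `hg` binder anywhere below.
* §1 DEAD SEQUENCES at the ₁₃ slot families: off-range ∕ zero-𝐓-slot ⇒ absent (`slotsOfRecord₁₃_succ_eq_zero_of_not_mem_range`, `…_of_slotsT_eq_zero`), absent ∕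
  non-live ⇒ dead (`fibreIntegral_termT₁₃_eq_zero_of_slotsT_eq_zero`, `…_of_not_live`), a dead sequence on the dead-moving branch is ABSENT from `ρ_{k+1}` with NO
  proviso (`slotsOfRecord₁₃_succ_eq_zero_of_dead`), and — under `Provisos₁₃.rstep` (integrable form) — at a fixed point receiving only dead sequences the post-𝐑 slot
  IS the pre-𝐑 slot ALMOST EVERYWHERE on the `χ_{k+1}`-support (`slotsOfRecord₁₃_succ_ae_eq_slotsT_of_fix_of_dead`; the a.e. support clause of p. 176 is exactly
  what the a.e. §2 identity consumes).
* §2 ★ THE LEAF ON THE DEAD-MOVING BRANCH: `TLaw₁₃ k → SLaw₁₃ (k+1)` and `ROpLeaf (VOfRecord₁₃ θ p)` for idempotent selectors moving only dead sequences, from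
  `Provisos₁₃`, admissibility and the displayed term-constant signs `0 ≤ κ, E₀, B₀` ALONE (`sLaw₁₃_succ_of_tLaw₁₃_of_idem_of_dead`, `rOpLeaf_VOfRecord₁₃_of_idem_of_dead`,
  law form `laws₁₃_of_idem_of_dead` = n24-c's (R₁₃) slot, `rOperation_leavesP_of_idem_of_dead₁₃`).
* §3 ★ (S1ᵀ) IS NEEDED ONLY AT THE LIVE SEQUENCES: `SLaw₁₃ (k+1)` from the 𝐓-image laws at every sequence + the §2 dichotomy at the sequences with non-zero fibre
  mass somewhere (`sLaw₁₃_succ_of_tLawLive_of_idem_of_dead`); Theorem 1 [III] at the objects of record `∀ k ≤ K, SLaw₁₃ θ p k` from that per-level input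
  (`sLaw₁₃_all_of_thmP245Live_of_idem_of_dead`) or from the full (S1ᵀ) (`sLaw₁₃_all_of_thmP245_of_idem_of_dead`; start = node00-def-T's theorem `sLaw₁₃_zero`;
  the induction `sLaw₁₃_all_of_laws` displayed once with BOTH law slots for n24-c's triple).
* §4 THE JUNCTION BY NAME: `densitiesDescribed`, N11's `Dag.B14_main (leavesP w P)` (n11-a's `b14_main_at_datumOfTower_of_propTower` at the Stage-13 core∕tower; the
  𝐑-antecedent REDUNDANT on this branch), the K1-shape `…_of_isRecordOfRecord₁₃C_datum…`, and the (B)-face's first conjunct `B16.Thm1Printed (datumOfRecord₁₃ θ h).C`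
  (node00-def-T's `thm1Printed_datumOfRecord₁₃_of_tLaw_rOpLeaf` with the leaf SUPPLIED) — each from (S1ᵀ) (full or live-only) alone.
* §5 ★ 𝐑 OF RECORD IS THE IDENTITY A.E. on the branch: `ρ_{k+1} = 𝐓ρ_k` a.e., `k < K` (`densOfRecord₁₃_succ_ae_eq_tdens_of_idem_of_dead`; under the integrable form a
  dead piece is a.e. zero by def-R's `ae_eq_zero_of_self_or_fibreIntegral_eq_zero` — no bound, no measurability binder).
* §6 ★ AT THE LIVE SELECTOR CLAUSE `hsel`: idempotency and «moved ⇒ dead» DISCHARGED (`ppSel_succ_idem_of_liveSel`, `dead_of_ppSel_succ_ne_of_liveSel`), so: the leaf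
  `rOpLeaf_VOfRecord₁₃_of_liveSel` ∕ `laws₁₃_of_liveSel` from `Provisos₁₃` + admissibility + signs; a non-live sequence is absent (`slotsOfRecord₁₃_succ_eq_zero_of_not_liveSeq_of_liveSel`,
  K0a's `LiveSeq` currency); (S)-from-(T-live) `sLaw₁₃_succ_of_tLawLiveSeq_of_liveSel`; Theorem 1 `sLaw₁₃_all_of_thmP245LiveSeq_of_liveSel`; the node
  `b14_main_at_record₁₃_of_lawsLive_of_liveSel`; the (B)-face conjunct `thm1Printed_datumOfRecord₁₃_of_lawsLive_of_liveSel`; `densOfRecord₁₃_succ_ae_eq_tdens_of_liveSel`.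

HONEST LABEL (as at ₁₂, now at the record the rev-16 items key to).  On the live-selector line 𝐑 of record integrates out only terms of zero fibre mass and is the
identity up to null sets (§5): N13's printed content ([B16] Thm 1's 𝐑-construction) is NOT exercised there, the 𝐑-leaf costs exactly `Provisos₁₃` (§6), and
Theorem 1 ∕ N11 ∕ the (B)-face's first conjunct rest on N11's (S1ᵀ) — AT THE LIVE SEQUENCES — alone.  (S1ᵀ) itself (the Theorem of p. 245 at the objects of record:
Sects. 1–3 of [III]) is NOT proved here; `Provisos₁₃` is a HYPOTHESIS (rows (H-U), P6, P11 of the K0′ lineage); nothing of Bałaban's analysis is asserted; K0″–K3″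
NOT discharged; counts unmoved; general `N`; one finite `𝕋⁴_{L^K}` programme at fixed `ε = L^{−K}` — NOT a continuum ∕ OS ∕ mass-gap ∕ Clay statement.

v1.1 (same seat; APPEND-ONLY — every v1.0 declaration byte-identical, no import change): §7 THE GENERAL-SELECTOR SOCKET at Stage 13 — the ₁₃ twin of
`…B16RLeafRecord12` §3 (p471403): for an ARBITRARY selector (a genuine 𝐑, moving LIVE sequences — the currency in which [B16] Theorem 1's 𝐑-construction is
exercised), `TLaw₁₃ k → SLaw₁₃ (k+1)` and `ROpLeaf (VOfRecord₁₃ θ p)` from ONE displayed hypothesis: the witnesses of the 𝐓-image form can be RE-PRESENTED by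
universal-𝐄 term values obeying the inductive assumptions at `k+1` such that at every PRESENT sequence `s′ ∈ range (θ.ppSel p g (k+1))` the post-𝐑 slot is absent or
equals `𝐓_{k+1}(s′) e^{A(t′ s′)}` a.e. on the `χ_{k+1}(s′)`-support — [IV] Prop. 1 (1.1)–(1.2) with [B16] (1.100)–(1.101) READ AT THE STAGE-13 OBJECTS OF RECORD
(`sLaw₁₃_succ_of_tLaw₁₃_of_absorbPresent`, `rOpLeaf_VOfRecord₁₃_of_absorbPresent`, law form `laws₁₃_of_absorbPresent`); off-range sequences are absent by §1.  This is the
DISCHARGE-SHAPED statement of N13's 𝐑-half at the record the rev-16 items key to — the socket a K1‴ witness that is NOT a live re-pin would have to fill; its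
hypothesis is NOT in the tree at the record and is NOT asserted.
-/

noncomputable section

open MeasureTheory
open scoped BigOperators Matrix.Norms.L2Operator

namespace Literature.MathematicalPhysics.QuantumFieldTheory.Balaban1983to89.B16RLeafRecord13Live

open T4Continuum T4DatumAssembly Node00 B14.Eq218Concrete DagBinding
open B16RLeafRecord11 B16RLeafRecord12 B16RLeafRecord12Live B16RLeafRecord12AtLive
open B14NodeKnitTowerDatum (densitiesDescribed_iff_core b14_main_at_datumOfTower_of_propTower)

variable (F : T4Family) (N : ℕ) [NeZero N]

/-! ## §0  The sign `0 ≤ g_{k+1}` is free along every Stage-13 history -/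

section FreeSign

/-- **EVERY GENERATED COUPLING OF POSITIVE LEVEL IS NON-NEGATIVE, Stage 13**: `gOfRecord₁₃ θ p (k+1) = genSeq β₁₃ g₀ (k+1) = solveCoupling (…) ≥ 0` (the (0.20)
forward solution is `1∕√y` or `0`), whatever the β re-point. [cite: Balaban1987RG1, (0.17)–(0.20) pp.255–256 (bookkeeping)] -/
theorem gOfRecord₁₃_succ_nonneg (θ : Stage13Params F N) (p : B12.RunParams) (k : ℕ) : 0 ≤ gOfRecord₁₃ F N θ p (k + 1) := by
  show 0 ≤ FlowStepRuns.genSeq _ _ (k + 1)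
  rw [FlowStepRuns.genSeq_succ]
  exact solveCoupling_nonneg _

end FreeSign

/-! ## §1  DEAD SEQUENCES at the Stage-13 slot families: absent, dead, and the a.e. identity at fixed points under the integrable-form `rstep` -/

section AtRecordSlots

variable (θ : Stage13Params F N) (p : B12.RunParams)

/-- **OFF THE RANGE OF `θ.ppSel p g (k+1)` THE POST-𝐑 SLOT OF `ρ_{k+1}` VANISHES IDENTICALLY**, Stage 13 (`slotsOfRecord_succ` + n13-c's empty-fibre lemma).
[cite: Balaban1989LargeFieldI, (0.3) p.176; Balaban1988Convergent, (2.17)–(2.18) p.257] -/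
theorem slotsOfRecord₁₃_succ_eq_zero_of_not_mem_range (k : ℕ)
    (s' : SeqOfRecord F θ.ν θ.τ9.M (gOfRecord₁₃ F N θ p) p.K (k + 1))
    (hs' : s' ∉ Set.range (θ.ppSel p (gOfRecord₁₃ F N θ p) (k + 1))) :
    slotsOfRecord F N θ.ν θ.τ9 (EOfRecord₁₃ F N θ) (wOfRecord₉ F N θ.toStage9Params) θ.ppSel p (gOfRecord₁₃ F N θ p) (k + 1) s' = 0 := by
  funext V
  rw [slotsOfRecord_succ]
  exact rstepSlotOfRecord_of_not_mem_range θ.ν θ.τ9 θ.ppSel p _ (k + 1) _ s' hs' V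

/-- **AN ABSENT 𝐓-SLOT GIVES AN ABSENT POST-𝐑 SLOT**, Stage 13. [cite: Balaban1989LargeFieldI, (0.3) p.176; Balaban1988Convergent, (3.24)–(3.25) p.270] -/
theorem slotsOfRecord₁₃_succ_eq_zero_of_slotsT_eq_zero (k : ℕ)
    (s' : SeqOfRecord F θ.ν θ.τ9.M (gOfRecord₁₃ F N θ p) p.K (k + 1))
    (h0 : slotsTOfRecord F N θ.ν θ.τ9 (EOfRecord₁₃ F N θ) (wOfRecord₉ F N θ.toStage9Params) θ.ppSel p (gOfRecord₁₃ F N θ p) (k + 1) s' = 0) :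
    slotsOfRecord F N θ.ν θ.τ9 (EOfRecord₁₃ F N θ) (wOfRecord₉ F N θ.toStage9Params) θ.ppSel p (gOfRecord₁₃ F N θ p) (k + 1) s' = 0 := by
  funext V
  rw [slotsOfRecord_succ]
  exact rstepSlotOfRecord_eq_zero_of_eq_zero θ.ν θ.τ9 θ.ppSel p _ (k + 1) _ s' h0 V

/-- **AN ABSENT 𝐓-SLOT IS DEAD**, Stage 13: if `slotT_{k+1}(a)` is the zero function, the restricted integral of its term over `Z′(a)` vanishes at every field.
[cite: Balaban1989LargeFieldI, (0.3) p.176 (bookkeeping); Balaban1988Convergent, (2.17)–(2.18) p.257] -/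
theorem fibreIntegral_termT₁₃_eq_zero_of_slotsT_eq_zero (k : ℕ)
    (a : SeqOfRecord F θ.ν θ.τ9.M (gOfRecord₁₃ F N θ p) p.K (k + 1))
    (h0 : slotsTOfRecord F N θ.ν θ.τ9 (EOfRecord₁₃ F N θ) (wOfRecord₉ F N θ.toStage9Params) θ.ppSel p (gOfRecord₁₃ F N θ p) (k + 1) a = 0)
    (V : GaugeField (F.P p.K) (k + 1) (SU N)) :
    B15.BasicStep.fibreIntegral (fibOfSeq F θ.ν θ.τ9 p (gOfRecord₁₃ F N θ p) (k + 1) a)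
        (rterm (sliceOfRecord F N θ.ν θ.τ9.M p (gOfRecord₁₃ F N θ p) (k + 1)
          (slotsTOfRecord F N θ.ν θ.τ9 (EOfRecord₁₃ F N θ) (wOfRecord₉ F N θ.toStage9Params) θ.ppSel p (gOfRecord₁₃ F N θ p) (k + 1))) a) V = 0 :=
  fibreIntegral_rterm_eq_zero_of_TexpA_eq_zero
    (sliceOfRecord F N θ.ν θ.τ9.M p (gOfRecord₁₃ F N θ p) (k + 1)
      (slotsTOfRecord F N θ.ν θ.τ9 (EOfRecord₁₃ F N θ) (wOfRecord₉ F N θ.toStage9Params) θ.ppSel p (gOfRecord₁₃ F N θ p) (k + 1)))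
    (fibOfSeq F θ.ν θ.τ9 p (gOfRecord₁₃ F N θ p) (k + 1)) a h0 V

/-- **A NON-LIVE SEQUENCE IS DEAD**, Stage 13 (hypothesis = the negated body of node00-def-K0a's `LiveSeq` at the pre-𝐑 family `slotT_{k+1}`).
[cite: Balaban1989LargeFieldI, (0.3) p.176; Balaban1988Convergent, (2.18) p.257] -/
theorem fibreIntegral_termT₁₃_eq_zero_of_not_live (k : ℕ)
    (a : SeqOfRecord F θ.ν θ.τ9.M (gOfRecord₁₃ F N θ p) p.K (k + 1))
    (hnl : ¬ ∃ V, slotsTOfRecord F N θ.ν θ.τ9 (EOfRecord₁₃ F N θ) (wOfRecord₉ F N θ.toStage9Params) θ.ppSel p (gOfRecord₁₃ F N θ p) (k + 1) a V ≠ 0 ∧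
      B15.BasicStep.fibreIntegral (fibOfSeq F θ.ν θ.τ9 p (gOfRecord₁₃ F N θ p) (k + 1) a)
        (rterm (sliceOfRecord F N θ.ν θ.τ9.M p (gOfRecord₁₃ F N θ p) (k + 1)
          (slotsTOfRecord F N θ.ν θ.τ9 (EOfRecord₁₃ F N θ) (wOfRecord₉ F N θ.toStage9Params) θ.ppSel p (gOfRecord₁₃ F N θ p) (k + 1))) a) V ≠ 0)
    (V : GaugeField (F.P p.K) (k + 1) (SU N)) :
    B15.BasicStep.fibreIntegral (fibOfSeq F θ.ν θ.τ9 p (gOfRecord₁₃ F N θ p) (k + 1) a)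
        (rterm (sliceOfRecord F N θ.ν θ.τ9.M p (gOfRecord₁₃ F N θ p) (k + 1)
          (slotsTOfRecord F N θ.ν θ.τ9 (EOfRecord₁₃ F N θ) (wOfRecord₉ F N θ.toStage9Params) θ.ppSel p (gOfRecord₁₃ F N θ p) (k + 1))) a) V = 0 :=
  fibreIntegral_rterm_eq_zero_of_not_live
    (sliceOfRecord F N θ.ν θ.τ9.M p (gOfRecord₁₃ F N θ p) (k + 1)
      (slotsTOfRecord F N θ.ν θ.τ9 (EOfRecord₁₃ F N θ) (wOfRecord₉ F N θ.toStage9Params) θ.ppSel p (gOfRecord₁₃ F N θ p) (k + 1)))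
    (fibOfSeq F θ.ν θ.τ9 p (gOfRecord₁₃ F N θ p) (k + 1)) a hnl V

/-- **ON THE DEAD-MOVING BRANCH A DEAD SEQUENCE IS ABSENT FROM `ρ_{k+1}`**, Stage 13 — its post-𝐑 slot is the zero function, POINTWISE, NO proviso
(`rstepOfSel_TexpA_eq_zero_of_dead_of_idem`: at a dead fixed point every ratio numerator vanishes, a dead moved sequence is off the range of the idempotent selector).
[cite: Balaban1989LargeFieldI, (0.3) p.176, p.177 (i)–(ii); Balaban1988Convergent, (2.17)–(2.18) p.257, (3.24)–(3.25) p.270] -/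
theorem slotsOfRecord₁₃_succ_eq_zero_of_dead (k : ℕ)
    (hidem : ∀ a, θ.ppSel p (gOfRecord₁₃ F N θ p) (k + 1) (θ.ppSel p (gOfRecord₁₃ F N θ p) (k + 1) a) = θ.ppSel p (gOfRecord₁₃ F N θ p) (k + 1) a)
    (hdead : ∀ a, θ.ppSel p (gOfRecord₁₃ F N θ p) (k + 1) a ≠ a →
      ∀ V, B15.BasicStep.fibreIntegral (fibOfSeq F θ.ν θ.τ9 p (gOfRecord₁₃ F N θ p) (k + 1) a)
        (rterm (sliceOfRecord F N θ.ν θ.τ9.M p (gOfRecord₁₃ F N θ p) (k + 1)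
          (slotsTOfRecord F N θ.ν θ.τ9 (EOfRecord₁₃ F N θ) (wOfRecord₉ F N θ.toStage9Params) θ.ppSel p (gOfRecord₁₃ F N θ p) (k + 1))) a) V = 0)
    (s : SeqOfRecord F θ.ν θ.τ9.M (gOfRecord₁₃ F N θ p) p.K (k + 1))
    (hs : ∀ V, B15.BasicStep.fibreIntegral (fibOfSeq F θ.ν θ.τ9 p (gOfRecord₁₃ F N θ p) (k + 1) s)
        (rterm (sliceOfRecord F N θ.ν θ.τ9.M p (gOfRecord₁₃ F N θ p) (k + 1)
          (slotsTOfRecord F N θ.ν θ.τ9 (EOfRecord₁₃ F N θ) (wOfRecord₉ F N θ.toStage9Params) θ.ppSel p (gOfRecord₁₃ F N θ p) (k + 1))) s) V = 0) :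
    slotsOfRecord F N θ.ν θ.τ9 (EOfRecord₁₃ F N θ) (wOfRecord₉ F N θ.toStage9Params) θ.ppSel p (gOfRecord₁₃ F N θ p) (k + 1) s = 0 := by
  funext V
  rw [slotsOfRecord_succ, Pi.zero_apply]
  unfold rstepSlotOfRecord rstepSlot
  refine rstepOfSel_TexpA_eq_zero_of_dead_of_idem
    (sliceOfRecord F N θ.ν θ.τ9.M p (gOfRecord₁₃ F N θ p) (k + 1)
      (slotsTOfRecord F N θ.ν θ.τ9 (EOfRecord₁₃ F N θ) (wOfRecord₉ F N θ.toStage9Params) θ.ppSel p (gOfRecord₁₃ F N θ p) (k + 1)))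
    (θ.ppSel p (gOfRecord₁₃ F N θ p) (k + 1)) (fibOfSeq F θ.ν θ.τ9 p (gOfRecord₁₃ F N θ p) (k + 1)) hidem ?_ s ?_ V
  · intro a hne W
    have H := hdead a hne W
    convert H using 2
  · intro W
    have H := hs W
    convert H using 2

/-- **AT A FIXED POINT `s′` OF `θ.ppSel p g (k+1)` ONTO WHICH ONLY DEAD SEQUENCES ARE SELECTED, THE POST-𝐑 SLOT OF `ρ_{k+1}` IS THE PRE-𝐑 SLOT OF `𝐓ρ_k` ALMOST
EVERYWHERE ON THE `χ_{k+1}(s′)`-SUPPORT**, Stage 13 — under `Provisos₁₃.rstep`, def-R's (0.3) provisos of the pre-𝐑 tower of record IN THE INTEGRABLE FORM, whose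
third conjunct is the support clause «`∫⌈_{Z′(s′)} t_{s″} = 0 at V ⇒ t_{s′}(V) = 0`» for ALMOST EVERY `V` (a dead selected sequence contributes the ratio
`0 ∕ ∫⌈t_{s′} = 0`; generic pointwise lemma `rstepSlotOfRecord_of_fix_of_dead` under the a.e. clause). [cite: Balaban1989LargeFieldI, (0.3) p.176, p.177 (i)–(ii); Balaban1988Convergent, (3.24)–(3.25) p.270] -/
theorem slotsOfRecord₁₃_succ_ae_eq_slotsT_of_fix_of_dead (h : θ.Provisos₁₃ F N) (k : ℕ) (hk : k < p.K)
    (s' : SeqOfRecord F θ.ν θ.τ9.M (gOfRecord₁₃ F N θ p) p.K (k + 1))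
    (hfix : θ.ppSel p (gOfRecord₁₃ F N θ p) (k + 1) s' = s')
    (hdead : ∀ a, θ.ppSel p (gOfRecord₁₃ F N θ p) (k + 1) a = s' → a ≠ s' →
      ∀ V, B15.BasicStep.fibreIntegral (fibOfSeq F θ.ν θ.τ9 p (gOfRecord₁₃ F N θ p) (k + 1) a)
        (rterm (sliceOfRecord F N θ.ν θ.τ9.M p (gOfRecord₁₃ F N θ p) (k + 1)
          (slotsTOfRecord F N θ.ν θ.τ9 (EOfRecord₁₃ F N θ) (wOfRecord₉ F N θ.toStage9Params) θ.ppSel p (gOfRecord₁₃ F N θ p) (k + 1))) a) V = 0) :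
    ∀ᵐ V ∂(fieldMeasure (F.P p.K) (k + 1) (SU N)),
      chiSeqOfRecord F N θ.ν θ.τ9.M (gOfRecord₁₃ F N θ p) p.K (k + 1) s' V ≠ 0 →
        slotsOfRecord F N θ.ν θ.τ9 (EOfRecord₁₃ F N θ) (wOfRecord₉ F N θ.toStage9Params) θ.ppSel p (gOfRecord₁₃ F N θ p) (k + 1) s' V
          = slotsTOfRecord F N θ.ν θ.τ9 (EOfRecord₁₃ F N θ) (wOfRecord₉ F N θ.toStage9Params) θ.ppSel p (gOfRecord₁₃ F N θ p) (k + 1) s' V := by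
  have HP := (h.rstep p k hk).2.2 s'
  filter_upwards [HP] with V hV
  intro hχ
  rw [slotsOfRecord_succ]
  refine rstepSlotOfRecord_of_fix_of_dead θ.ν θ.τ9 θ.ppSel p _ (k + 1) _ s' hfix (fun a ha hne W => hdead a ha hne W) V ?_ hχ
  have H : B15.BasicStep.fibreIntegral (fibOfSeq F θ.ν θ.τ9 p (gOfRecord₁₃ F N θ p) (k + 1) s')
      (rterm (repr218OfRecord F N θ.ν θ.τ9.M (slotsTOfRecord F N θ.ν θ.τ9 (EOfRecord₁₃ F N θ)
        (wOfRecord₉ F N θ.toStage9Params) θ.ppSel) p (gOfRecord₁₃ F N θ p) (k + 1))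
        (θ.ppSel p (gOfRecord₁₃ F N θ p) (k + 1) s')) V = 0 →
      rterm (repr218OfRecord F N θ.ν θ.τ9.M (slotsTOfRecord F N θ.ν θ.τ9 (EOfRecord₁₃ F N θ)
        (wOfRecord₉ F N θ.toStage9Params) θ.ppSel) p (gOfRecord₁₃ F N θ p) (k + 1)) s' V = 0 := hV
  rw [hfix] at H
  intro h0
  apply H
  convert h0 using 2
  rfl

end AtRecordSlots

/-! ## §2  ★ THE LEAF ON THE DEAD-MOVING (= live-selector) BRANCH, Stage 13: from the provisos, admissibility and the term-constant signs alone -/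

section LiveBranch

variable (θ : Stage13Params F N) (p : B12.RunParams)

/-- **`TLaw₁₃ k → SLaw₁₃ (k+1)` WHEN THE LEVEL-`k+1` SELECTOR IS IDEMPOTENT AND MOVES ONLY DEAD SEQUENCES**, Stage 13: the 𝐓-image §2 form of `𝐓ρ_k`'s slots
(dichotomy form) gives the §2 form of `ρ_{k+1}`'s slots at index `k+1` with the SAME term values and constants — the laws by p. 262 [III]
(`HasSect2FormTAEZ.toFormAEZ_succ` under `0 ≤ β` (admissibility), the displayed `0 ≤ κ, E₀, B₀`, and `0 ≤ g_{k+1}` (§0, free)); OFF the range the post-𝐑 slot is absent;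
ON the range (fixed points, by idempotency) an absent 𝐓-slot stays absent and a present one keeps its a.e. identity along `slot_{k+1}(s′) = slotT_{k+1}(s′)` a.e. on the
`χ_{k+1}(s′)`-support (§1, integrable-form `rstep`).  HONEST SCOPE: on this branch 𝐑 integrates out only terms of zero fibre mass.
[cite: Balaban1988Convergent, §2 p.262, Thm 2 p.263, (3.24)–(3.25) p.270; Balaban1989LargeFieldI, (0.3) p.176, p.177 (i)–(ii)] -/
theorem sLaw₁₃_succ_of_tLaw₁₃_of_idem_of_dead (h : θ.Provisos₁₃ F N) (hθ : θ.Admissible F N) (hκ : 0 ≤ θ.s2.lf.κ) (hE₀ : 0 ≤ θ.s2.lf.E₀)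
    (hB₀ : 0 ≤ θ.s2.lf.B₀) (k : ℕ) (hk : k < p.K)
    (hidem : ∀ a, θ.ppSel p (gOfRecord₁₃ F N θ p) (k + 1) (θ.ppSel p (gOfRecord₁₃ F N θ p) (k + 1) a) = θ.ppSel p (gOfRecord₁₃ F N θ p) (k + 1) a)
    (hdead : ∀ a, θ.ppSel p (gOfRecord₁₃ F N θ p) (k + 1) a ≠ a →
      ∀ V, B15.BasicStep.fibreIntegral (fibOfSeq F θ.ν θ.τ9 p (gOfRecord₁₃ F N θ p) (k + 1) a)
        (rterm (sliceOfRecord F N θ.ν θ.τ9.M p (gOfRecord₁₃ F N θ p) (k + 1)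
          (slotsTOfRecord F N θ.ν θ.τ9 (EOfRecord₁₃ F N θ) (wOfRecord₉ F N θ.toStage9Params) θ.ppSel p (gOfRecord₁₃ F N θ p) (k + 1))) a) V = 0)
    (hT : TLaw₁₃ F N θ p k) : SLaw₁₃ F N θ p (k + 1) := by
  rw [sLaw₁₃_iff]
  have hA := ((tLaw₁₃_iff F N θ p k).mp hT).toFormAEZ_succ hθ.toStage12.pos.2.1 hκ hE₀ hB₀ (gOfRecord₁₃_succ_nonneg F N θ p k)
  obtain ⟨t, Ek, hu, hs⟩ := hA
  refine ⟨t, Ek, hu, fun s => ⟨(hs s).1, ?_⟩⟩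
  by_cases hmem : s ∈ Set.range (θ.ppSel p (gOfRecord₁₃ F N θ p) (k + 1))
  · obtain ⟨b, hb⟩ := hmem
    have hfix : θ.ppSel p (gOfRecord₁₃ F N θ p) (k + 1) s = s := by rw [← hb]; exact hidem b
    rcases (hs s).2 with h0 | hid
    · exact Or.inl (slotsOfRecord₁₃_succ_eq_zero_of_slotsT_eq_zero F N θ p k s h0)
    · refine Or.inr ?_
      filter_upwards [hid, slotsOfRecord₁₃_succ_ae_eq_slotsT_of_fix_of_dead F N θ p h k hk s hfix
        (fun a ha hne => hdead a fun heq => hne (heq.symm.trans ha))] with V hV hVid hχ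
      rw [hVid hχ]
      exact hV hχ
  · exact Or.inl (slotsOfRecord₁₃_succ_eq_zero_of_not_mem_range F N θ p k s hmem)

/-- **★ THE 𝐑-LEAF OF RECORD AT STAGE 13, INHABITED ON THE DEAD-MOVING BRANCH**: if at every level `k < K` the selector `θ.ppSel p g (k+1)` is idempotent and moves
only dead sequences, then — under the provisos, admissibility and the displayed term-constant signs, NOTHING ELSE — `ROpLeaf (VOfRecord₁₃ F N θ p)`: the junction
Prop node N13 produces and node N11 consumes.  [B16] Theorem 1's 𝐑-construction is not exercised on this branch. [cite: Balaban1988Convergent, p.244, Thm 2 p.263, §2 p.262; Balaban1989LargeFieldI, (0.3) p.176, p.177 (i)–(ii); Balaban1989LargeFieldII, Thm 1 p.355 (what the general case needs)] -/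
theorem rOpLeaf_VOfRecord₁₃_of_idem_of_dead (h : θ.Provisos₁₃ F N) (hθ : θ.Admissible F N) (hκ : 0 ≤ θ.s2.lf.κ) (hE₀ : 0 ≤ θ.s2.lf.E₀)
    (hB₀ : 0 ≤ θ.s2.lf.B₀)
    (hidem : ∀ k, k < p.K → ∀ a, θ.ppSel p (gOfRecord₁₃ F N θ p) (k + 1)
      (θ.ppSel p (gOfRecord₁₃ F N θ p) (k + 1) a) = θ.ppSel p (gOfRecord₁₃ F N θ p) (k + 1) a)
    (hdead : ∀ k, k < p.K → ∀ a, θ.ppSel p (gOfRecord₁₃ F N θ p) (k + 1) a ≠ a →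
      ∀ V, B15.BasicStep.fibreIntegral (fibOfSeq F θ.ν θ.τ9 p (gOfRecord₁₃ F N θ p) (k + 1) a)
        (rterm (sliceOfRecord F N θ.ν θ.τ9.M p (gOfRecord₁₃ F N θ p) (k + 1)
          (slotsTOfRecord F N θ.ν θ.τ9 (EOfRecord₁₃ F N θ) (wOfRecord₉ F N θ.toStage9Params) θ.ppSel p (gOfRecord₁₃ F N θ p) (k + 1))) a) V = 0) :
    ROpLeaf (VOfRecord₁₃ F N θ p) := by
  rw [rOpLeaf_VOfRecord₁₃_iff]
  intro k hk hT
  exact sLaw₁₃_succ_of_tLaw₁₃_of_idem_of_dead F N θ p h hθ hκ hE₀ hB₀ k hk (hidem k hk) (hdead k hk) hT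

/-- **The same leaf IN LAW FORM** — the (R₁₃) slot of dag-n24-c's `B16NodeKnitRecord13.nodes_N11_N13_at_record₁₃` ∕ node00-def-T's `rOperation_upOfRecord₅C_stage13_iff`:
`∀ k < K, TLaw₁₃ θ p k → SLaw₁₃ θ p (k+1)` on the dead-moving branch. [cite: Balaban1988Convergent, p.244 (bookkeeping); Balaban1989LargeFieldII, Thm 1 p.355 (not exercised)] -/
theorem laws₁₃_of_idem_of_dead (h : θ.Provisos₁₃ F N) (hθ : θ.Admissible F N) (hκ : 0 ≤ θ.s2.lf.κ) (hE₀ : 0 ≤ θ.s2.lf.E₀) (hB₀ : 0 ≤ θ.s2.lf.B₀)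
    (hidem : ∀ k, k < p.K → ∀ a, θ.ppSel p (gOfRecord₁₃ F N θ p) (k + 1)
      (θ.ppSel p (gOfRecord₁₃ F N θ p) (k + 1) a) = θ.ppSel p (gOfRecord₁₃ F N θ p) (k + 1) a)
    (hdead : ∀ k, k < p.K → ∀ a, θ.ppSel p (gOfRecord₁₃ F N θ p) (k + 1) a ≠ a →
      ∀ V, B15.BasicStep.fibreIntegral (fibOfSeq F θ.ν θ.τ9 p (gOfRecord₁₃ F N θ p) (k + 1) a)
        (rterm (sliceOfRecord F N θ.ν θ.τ9.M p (gOfRecord₁₃ F N θ p) (k + 1)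
          (slotsTOfRecord F N θ.ν θ.τ9 (EOfRecord₁₃ F N θ) (wOfRecord₉ F N θ.toStage9Params) θ.ppSel p (gOfRecord₁₃ F N θ p) (k + 1))) a) V = 0) :
    ∀ k, k < p.K → TLaw₁₃ F N θ p k → SLaw₁₃ F N θ p (k + 1) :=
  (rOpLeaf_VOfRecord₁₃_iff F N θ p).mp (rOpLeaf_VOfRecord₁₃_of_idem_of_dead F N θ p h hθ hκ hE₀ hB₀ hidem hdead)

/-- **THE RUN's `rOperation` LEAF READS TRUE at any world whose `up`-slots are NODE 00's C-binding of record over the Stage-13 view, on the dead-moving branch**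
(node00-def-T's pin `rOperation_upOfRecord₅C_stage13_iff`). [cite: Balaban1988Convergent, p.244; Balaban1989LargeFieldII, Thm 1 p.355 (bookkeeping at the record)] -/
theorem rOperation_leavesP_of_idem_of_dead₁₃ (w : WorldP) (hup : w.up p = upOfRecord₅C F N (θ.toStage5₁₃ F N) p) (h : θ.Provisos₁₃ F N)
    (hθ : θ.Admissible F N) (hκ : 0 ≤ θ.s2.lf.κ) (hE₀ : 0 ≤ θ.s2.lf.E₀) (hB₀ : 0 ≤ θ.s2.lf.B₀)
    (hidem : ∀ k, k < p.K → ∀ a, θ.ppSel p (gOfRecord₁₃ F N θ p) (k + 1)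
      (θ.ppSel p (gOfRecord₁₃ F N θ p) (k + 1) a) = θ.ppSel p (gOfRecord₁₃ F N θ p) (k + 1) a)
    (hdead : ∀ k, k < p.K → ∀ a, θ.ppSel p (gOfRecord₁₃ F N θ p) (k + 1) a ≠ a →
      ∀ V, B15.BasicStep.fibreIntegral (fibOfSeq F θ.ν θ.τ9 p (gOfRecord₁₃ F N θ p) (k + 1) a)
        (rterm (sliceOfRecord F N θ.ν θ.τ9.M p (gOfRecord₁₃ F N θ p) (k + 1)
          (slotsTOfRecord F N θ.ν θ.τ9 (EOfRecord₁₃ F N θ) (wOfRecord₉ F N θ.toStage9Params) θ.ppSel p (gOfRecord₁₃ F N θ p) (k + 1))) a) V = 0) :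
    (leavesP w p).rOperation := by
  show (w.up p).rOperation
  rw [hup, rOperation_upOfRecord₅C_stage13_iff]
  exact laws₁₃_of_idem_of_dead F N θ p h hθ hκ hE₀ hB₀ hidem hdead

end LiveBranch

/-! ## §3  ★ (S1ᵀ) IS NEEDED ONLY AT THE LIVE SEQUENCES: (S)-from-(T-live), and Theorem 1 [III] at the Stage-13 objects of record -/

section LiveOnly

variable (θ : Stage13Params F N) (p : B12.RunParams)

/-- **THEOREM 1 [III]'s INDUCTION AT THE STAGE-13 LAWS OF RECORD, BOTH SLOTS DISPLAYED** (the START is node00-def-T's theorem `sLaw₁₃_zero`): from the 𝐑-slot in law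
form `hR : ∀ k < K, TLaw₁₃ k → SLaw₁₃ (k+1)` and the Theorem of p. 245 at the objects of record `hT : ∀ k < K, SLaw₁₃ k → TLaw₁₃ k`: `∀ k ≤ K, SLaw₁₃ θ p k`.
[cite: Balaban1988Convergent, Thm 1 p.262; Theorem p.245; p.244] -/
theorem sLaw₁₃_all_of_laws (hR : ∀ k, k < p.K → TLaw₁₃ F N θ p k → SLaw₁₃ F N θ p (k + 1))
    (hT : ∀ k, k < p.K → SLaw₁₃ F N θ p k → TLaw₁₃ F N θ p k) :
    ∀ k, k ≤ p.K → SLaw₁₃ F N θ p k := by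
  intro k
  induction k with
  | zero => exact fun _ => sLaw₁₃_zero F N θ p
  | succ n ih =>
    intro hk
    exact hR n (Nat.lt_of_succ_le hk) (hT n (Nat.lt_of_succ_le hk) (ih (Nat.le_of_succ_le hk)))

/-- **★ THEOREM 1 [III] AT THE STAGE-13 OBJECTS OF RECORD FROM N11's ONE SLOT (S1ᵀ) ALONE, ON THE DEAD-MOVING BRANCH**: the 𝐑-slot is §2's THEOREM, so only
`hT` — the Theorem of p. 245 at the objects of record — and the displayed signs remain: EVERY `ρ_k` of record, `k ≤ K`, has the repaired §2 [III] form of record.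
[cite: Balaban1988Convergent, Thm 1 p.262; Theorem p.245; p.244; Balaban1989LargeFieldI, (0.3) p.176, p.177 (i)–(ii)] -/
theorem sLaw₁₃_all_of_thmP245_of_idem_of_dead (h : θ.Provisos₁₃ F N) (hθ : θ.Admissible F N) (hκ : 0 ≤ θ.s2.lf.κ) (hE₀ : 0 ≤ θ.s2.lf.E₀)
    (hB₀ : 0 ≤ θ.s2.lf.B₀)
    (hidem : ∀ k, k < p.K → ∀ a, θ.ppSel p (gOfRecord₁₃ F N θ p) (k + 1)
      (θ.ppSel p (gOfRecord₁₃ F N θ p) (k + 1) a) = θ.ppSel p (gOfRecord₁₃ F N θ p) (k + 1) a)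
    (hdead : ∀ k, k < p.K → ∀ a, θ.ppSel p (gOfRecord₁₃ F N θ p) (k + 1) a ≠ a →
      ∀ V, B15.BasicStep.fibreIntegral (fibOfSeq F θ.ν θ.τ9 p (gOfRecord₁₃ F N θ p) (k + 1) a)
        (rterm (sliceOfRecord F N θ.ν θ.τ9.M p (gOfRecord₁₃ F N θ p) (k + 1)
          (slotsTOfRecord F N θ.ν θ.τ9 (EOfRecord₁₃ F N θ) (wOfRecord₉ F N θ.toStage9Params) θ.ppSel p (gOfRecord₁₃ F N θ p) (k + 1))) a) V = 0)
    (hT : ∀ k, k < p.K → SLaw₁₃ F N θ p k → TLaw₁₃ F N θ p k) :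
    ∀ k, k ≤ p.K → SLaw₁₃ F N θ p k :=
  sLaw₁₃_all_of_laws F N θ p (laws₁₃_of_idem_of_dead F N θ p h hθ hκ hE₀ hB₀ hidem hdead) hT

/-- **★ `TLaw` AT THE LIVE SEQUENCES ONLY ⇒ `SLaw₁₃ (k+1)`, dead-moving branch** (generic θ): if the 𝐓-image slots of `𝐓ρ_k` are re-presented by universal-𝐄 term values
obeying `Sect2.LawsT … k` AT EVERY SEQUENCE and satisfying the §2 dichotomy («absent, or the §2 identity a.e. on the `χ_{k+1}`-support») ONLY AT THE SEQUENCES WITH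
NON-ZERO FIBRE MASS SOMEWHERE (the live ones), then `ρ_{k+1}` has the repaired §2 form: dead sequences are absent from `ρ_{k+1}` (§1, no proviso), a live sequence is a
fixed point (moved ones are dead) where the post-𝐑 slot IS the pre-𝐑 slot a.e. on the support (§1, integrable-form `rstep`), and the laws pass to `k+1` by p. 262
(`LawsT.toRT_succ`; `0 ≤ g_{k+1}` by §0).  `TLaw₁₃ θ p k` implies the hypothesis (drop the guard). [cite: Balaban1988Convergent, §2 p.262, Thm 2 p.263, (3.24)–(3.25) p.270; Balaban1989LargeFieldI, (0.3) p.176, p.177 (i)–(ii)] -/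
theorem sLaw₁₃_succ_of_tLawLive_of_idem_of_dead (h : θ.Provisos₁₃ F N) (hθ : θ.Admissible F N) (hκ : 0 ≤ θ.s2.lf.κ) (hE₀ : 0 ≤ θ.s2.lf.E₀)
    (hB₀ : 0 ≤ θ.s2.lf.B₀) (k : ℕ) (hk : k < p.K)
    (hidem : ∀ a, θ.ppSel p (gOfRecord₁₃ F N θ p) (k + 1) (θ.ppSel p (gOfRecord₁₃ F N θ p) (k + 1) a) = θ.ppSel p (gOfRecord₁₃ F N θ p) (k + 1) a)
    (hdead : ∀ a, θ.ppSel p (gOfRecord₁₃ F N θ p) (k + 1) a ≠ a →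
      ∀ V, B15.BasicStep.fibreIntegral (fibOfSeq F θ.ν θ.τ9 p (gOfRecord₁₃ F N θ p) (k + 1) a)
        (rterm (sliceOfRecord F N θ.ν θ.τ9.M p (gOfRecord₁₃ F N θ p) (k + 1)
          (slotsTOfRecord F N θ.ν θ.τ9 (EOfRecord₁₃ F N θ) (wOfRecord₉ F N θ.toStage9Params) θ.ppSel p (gOfRecord₁₃ F N θ p) (k + 1))) a) V = 0)
    (hT : ∃ (t : SeqOfRecord F θ.ν θ.τ9.M (gOfRecord₁₃ F N θ p) p.K (k + 1) → Sect2.TermValues (F.P p.K) (MatA N) (FluctV N) θ.τ9.M)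
      (Ek : SeqOfRecord F θ.ν θ.τ9.M (gOfRecord₁₃ F N θ p) p.K (k + 1) → ℝ), Sect2.UniversalE t ∧
      ∀ s, Sect2.LawsT (sect2TowerOfRecord F N (FluctV N) p.K (settingOfRecord₁₃ F N θ p) (θ.Rz p.K) s (t s)) (settingOfRecord₁₃ F N θ p).lf
          (settingOfRecord₁₃ F N θ p).βc k ∧
        ((∃ V, B15.BasicStep.fibreIntegral (fibOfSeq F θ.ν θ.τ9 p (gOfRecord₁₃ F N θ p) (k + 1) s)
        (rterm (sliceOfRecord F N θ.ν θ.τ9.M p (gOfRecord₁₃ F N θ p) (k + 1)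
          (slotsTOfRecord F N θ.ν θ.τ9 (EOfRecord₁₃ F N θ) (wOfRecord₉ F N θ.toStage9Params) θ.ppSel p (gOfRecord₁₃ F N θ p) (k + 1))) s) V ≠ 0) →
          (slotsTOfRecord F N θ.ν θ.τ9 (EOfRecord₁₃ F N θ) (wOfRecord₉ F N θ.toStage9Params) θ.ppSel p (gOfRecord₁₃ F N θ p) (k + 1) s = 0 ∨
            ∀ᵐ V ∂(fieldMeasure (F.P p.K) (k + 1) (SU N)), chiSeqOfRecord F N θ.ν θ.τ9.M (gOfRecord₁₃ F N θ p) p.K (k + 1) s V ≠ 0 →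
              slotsTOfRecord F N θ.ν θ.τ9 (EOfRecord₁₃ F N θ) (wOfRecord₉ F N θ.toStage9Params) θ.ppSel p (gOfRecord₁₃ F N θ p) (k + 1) s V
                = sect2Slot F N (FluctV N) p.K (settingOfRecord₁₃ F N θ p) (θ.Rz p.K) (WtOfRecord₁₃ F N θ p) s (t s) (Ek s)
                    (UbgOfRecord₁₃ F N θ p (k + 1) s) V))) :
    SLaw₁₃ F N θ p (k + 1) := by
  rw [sLaw₁₃_iff]
  obtain ⟨t, Ek, hu, hs⟩ := hT
  refine ⟨t, Ek, hu, fun s => ⟨(hs s).1.toRT_succ hθ.toStage12.pos.2.1 hκ hE₀ hB₀ (gOfRecord₁₃_succ_nonneg F N θ p k), ?_⟩⟩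
  by_cases hsd : ∀ V, B15.BasicStep.fibreIntegral (fibOfSeq F θ.ν θ.τ9 p (gOfRecord₁₃ F N θ p) (k + 1) s)
        (rterm (sliceOfRecord F N θ.ν θ.τ9.M p (gOfRecord₁₃ F N θ p) (k + 1)
          (slotsTOfRecord F N θ.ν θ.τ9 (EOfRecord₁₃ F N θ) (wOfRecord₉ F N θ.toStage9Params) θ.ppSel p (gOfRecord₁₃ F N θ p) (k + 1))) s) V = 0
  · exact Or.inl (slotsOfRecord₁₃_succ_eq_zero_of_dead F N θ p k hidem hdead s hsd)
  · have hlive : ∃ V, B15.BasicStep.fibreIntegral (fibOfSeq F θ.ν θ.τ9 p (gOfRecord₁₃ F N θ p) (k + 1) s)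
        (rterm (sliceOfRecord F N θ.ν θ.τ9.M p (gOfRecord₁₃ F N θ p) (k + 1)
          (slotsTOfRecord F N θ.ν θ.τ9 (EOfRecord₁₃ F N θ) (wOfRecord₉ F N θ.toStage9Params) θ.ppSel p (gOfRecord₁₃ F N θ p) (k + 1))) s) V ≠ 0 := by
      by_contra hnone
      exact hsd fun V => by_contra fun hV => hnone ⟨V, hV⟩
    have hfix : θ.ppSel p (gOfRecord₁₃ F N θ p) (k + 1) s = s := by
      by_contra hne
      exact hsd (hdead s hne)
    rcases (hs s).2 hlive with h0 | hid
    · exact Or.inl (slotsOfRecord₁₃_succ_eq_zero_of_slotsT_eq_zero F N θ p k s h0)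
    · refine Or.inr ?_
      filter_upwards [hid, slotsOfRecord₁₃_succ_ae_eq_slotsT_of_fix_of_dead F N θ p h k hk s hfix
        (fun a ha hne => hdead a fun heq => hne (heq.symm.trans ha))] with V hV hVid hχ
      rw [hVid hχ]
      exact hV hχ

/-- **★ THEOREM 1 [III] AT THE STAGE-13 OBJECTS OF RECORD FROM (S1ᵀ) AT THE LIVE SEQUENCES ONLY, dead-moving branch**: from «`SLaw₁₃ θ p k ⇒` the 𝐓-image laws at
every sequence + the §2 dichotomy at the LIVE sequences of `𝐓ρ_k`», `k < K`, and the displayed signs: `∀ k ≤ K, SLaw₁₃ θ p k` (induction from `sLaw₁₃_zero`).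
[cite: Balaban1988Convergent, Thm 1 p.262; Theorem p.245; p.244; Balaban1989LargeFieldI, (0.3) p.176, p.177 (i)–(ii)] -/
theorem sLaw₁₃_all_of_thmP245Live_of_idem_of_dead (h : θ.Provisos₁₃ F N) (hθ : θ.Admissible F N) (hκ : 0 ≤ θ.s2.lf.κ) (hE₀ : 0 ≤ θ.s2.lf.E₀)
    (hB₀ : 0 ≤ θ.s2.lf.B₀)
    (hidem : ∀ k, k < p.K → ∀ a, θ.ppSel p (gOfRecord₁₃ F N θ p) (k + 1)
      (θ.ppSel p (gOfRecord₁₃ F N θ p) (k + 1) a) = θ.ppSel p (gOfRecord₁₃ F N θ p) (k + 1) a)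
    (hdead : ∀ k, k < p.K → ∀ a, θ.ppSel p (gOfRecord₁₃ F N θ p) (k + 1) a ≠ a →
      ∀ V, B15.BasicStep.fibreIntegral (fibOfSeq F θ.ν θ.τ9 p (gOfRecord₁₃ F N θ p) (k + 1) a)
        (rterm (sliceOfRecord F N θ.ν θ.τ9.M p (gOfRecord₁₃ F N θ p) (k + 1)
          (slotsTOfRecord F N θ.ν θ.τ9 (EOfRecord₁₃ F N θ) (wOfRecord₉ F N θ.toStage9Params) θ.ppSel p (gOfRecord₁₃ F N θ p) (k + 1))) a) V = 0)
    (hT : ∀ k, k < p.K → SLaw₁₃ F N θ p k →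
      ∃ (t : SeqOfRecord F θ.ν θ.τ9.M (gOfRecord₁₃ F N θ p) p.K (k + 1) → Sect2.TermValues (F.P p.K) (MatA N) (FluctV N) θ.τ9.M)
      (Ek : SeqOfRecord F θ.ν θ.τ9.M (gOfRecord₁₃ F N θ p) p.K (k + 1) → ℝ), Sect2.UniversalE t ∧
      ∀ s, Sect2.LawsT (sect2TowerOfRecord F N (FluctV N) p.K (settingOfRecord₁₃ F N θ p) (θ.Rz p.K) s (t s)) (settingOfRecord₁₃ F N θ p).lf
          (settingOfRecord₁₃ F N θ p).βc k ∧
        ((∃ V, B15.BasicStep.fibreIntegral (fibOfSeq F θ.ν θ.τ9 p (gOfRecord₁₃ F N θ p) (k + 1) s)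
        (rterm (sliceOfRecord F N θ.ν θ.τ9.M p (gOfRecord₁₃ F N θ p) (k + 1)
          (slotsTOfRecord F N θ.ν θ.τ9 (EOfRecord₁₃ F N θ) (wOfRecord₉ F N θ.toStage9Params) θ.ppSel p (gOfRecord₁₃ F N θ p) (k + 1))) s) V ≠ 0) →
          (slotsTOfRecord F N θ.ν θ.τ9 (EOfRecord₁₃ F N θ) (wOfRecord₉ F N θ.toStage9Params) θ.ppSel p (gOfRecord₁₃ F N θ p) (k + 1) s = 0 ∨
            ∀ᵐ V ∂(fieldMeasure (F.P p.K) (k + 1) (SU N)), chiSeqOfRecord F N θ.ν θ.τ9.M (gOfRecord₁₃ F N θ p) p.K (k + 1) s V ≠ 0 →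
              slotsTOfRecord F N θ.ν θ.τ9 (EOfRecord₁₃ F N θ) (wOfRecord₉ F N θ.toStage9Params) θ.ppSel p (gOfRecord₁₃ F N θ p) (k + 1) s V
                = sect2Slot F N (FluctV N) p.K (settingOfRecord₁₃ F N θ p) (θ.Rz p.K) (WtOfRecord₁₃ F N θ p) s (t s) (Ek s)
                    (UbgOfRecord₁₃ F N θ p (k + 1) s) V))) :
    ∀ k, k ≤ p.K → SLaw₁₃ F N θ p k := by
  intro k
  induction k with
  | zero => exact fun _ => sLaw₁₃_zero F N θ p
  | succ n ih =>
    intro hk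
    exact sLaw₁₃_succ_of_tLawLive_of_idem_of_dead F N θ p h hθ hκ hE₀ hB₀ n (Nat.lt_of_succ_le hk) (hidem n (Nat.lt_of_succ_le hk))
      (hdead n (Nat.lt_of_succ_le hk)) (hT n (Nat.lt_of_succ_le hk) (ih (Nat.le_of_succ_le hk)))

end LiveOnly

/-! ## §4  THE N11∕N13 JUNCTION COMPOSED BY NAME at the Stage-13 record, dead-moving branch: `densitiesDescribed`, the node, the K1-shape, the (B)-face's first conjunct -/

section Junction

variable (θ : Stage13Params F N) (p : B12.RunParams) (w : WorldP) (h : θ.Provisos₁₃ F N)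

/-- **Theorem 1's conclusion `densitiesDescribed` AT A STAGE-13 WORLD FROM THE TWO LAW SLOTS** (no start hypothesis): at `w.C = (datumOfRecord₁₃ F N θ h).C`, the
𝐑-slot in law form + the Theorem of p. 245 at the objects of record give `(leavesP w p).densitiesDescribed` (`densitiesDescribed_iff_core` at the Stage-13 core∕tower;
the core's clause IS `SLaw₁₃`, `sect2Form_coreOfRecord₁₃_iff`). [cite: Balaban1988Convergent, Thm 1 p.262; Theorem p.245; p.244] -/
theorem densitiesDescribed_at_record₁₃_of_laws (hC : w.C = (datumOfRecord₁₃ F N θ h).C)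
    (hR : ∀ k, k < p.K → TLaw₁₃ F N θ p k → SLaw₁₃ F N θ p (k + 1)) (hT : ∀ k, k < p.K → SLaw₁₃ F N θ p k → TLaw₁₃ F N θ p k) :
    (leavesP w p).densitiesDescribed :=
  (densitiesDescribed_iff_core F N (coreOfRecord₁₃ F N θ) (towerOfRecord₁₃ F N θ h) w p hC).2 (sLaw₁₃_all_of_laws F N θ p hR hT)

/-- **`densitiesDescribed` AT A STAGE-13 WORLD FROM (S1ᵀ) ALONE, dead-moving branch** (the 𝐑-slot SUPPLIED by §2). [cite: Balaban1988Convergent, Thm 1 p.262; Theorem p.245; p.244] -/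
theorem densitiesDescribed_at_record₁₃_of_idem_of_dead (hC : w.C = (datumOfRecord₁₃ F N θ h).C) (hθ : θ.Admissible F N) (hκ : 0 ≤ θ.s2.lf.κ)
    (hE₀ : 0 ≤ θ.s2.lf.E₀) (hB₀ : 0 ≤ θ.s2.lf.B₀)
    (hidem : ∀ k, k < p.K → ∀ a, θ.ppSel p (gOfRecord₁₃ F N θ p) (k + 1)
      (θ.ppSel p (gOfRecord₁₃ F N θ p) (k + 1) a) = θ.ppSel p (gOfRecord₁₃ F N θ p) (k + 1) a)
    (hdead : ∀ k, k < p.K → ∀ a, θ.ppSel p (gOfRecord₁₃ F N θ p) (k + 1) a ≠ a →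
      ∀ V, B15.BasicStep.fibreIntegral (fibOfSeq F θ.ν θ.τ9 p (gOfRecord₁₃ F N θ p) (k + 1) a)
        (rterm (sliceOfRecord F N θ.ν θ.τ9.M p (gOfRecord₁₃ F N θ p) (k + 1)
          (slotsTOfRecord F N θ.ν θ.τ9 (EOfRecord₁₃ F N θ) (wOfRecord₉ F N θ.toStage9Params) θ.ppSel p (gOfRecord₁₃ F N θ p) (k + 1))) a) V = 0)
    (hT : ∀ k, k < p.K → SLaw₁₃ F N θ p k → TLaw₁₃ F N θ p k) :
    (leavesP w p).densitiesDescribed :=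
  densitiesDescribed_at_record₁₃_of_laws F N θ p w h hC (laws₁₃_of_idem_of_dead F N θ p h hθ hκ hE₀ hB₀ hidem hdead) hT

/-- **N11 · `Dag.B14_main (leavesP w P)` AT A STAGE-13 WORLD, 𝐑 READ THROUGH THE LEAF AT THE CARRIERS OF RECORD, ONE DISPLAYED SLOT** ([Balaban1988Convergent] Thm 1
p. 262 with the Theorem of p. 245 and the assumed 𝐑 of p. 244 at NODE 00's Stage-13 objects of record): pin `hC`; reading `hV` — the run's `rOperation` antecedent names
`ROpLeaf (VOfRecord₁₃ θ P)` (by the C-binding of record it is an `Iff`, `rOperation_upOfRecord₅C_stage13_iff`); slot (S1ᵀ) `hT` GIVEN the node's in-edges `b7 … b11`, the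
interval hypothesis, the small-field inductive assumptions and the flow control.  START = node00-def-T's `sLaw₁₃_zero`; composition = n11-a's
`b14_main_at_datumOfTower_of_propTower` at `InS := SLaw₁₃ θ P`, `InT := TLaw₁₃ θ P` (the datum of record IS `datumOfTower … (coreOfRecord₁₃ …) (towerOfRecord₁₃ …)`).
Count-neutral slot landing. [cite: Balaban1988Convergent, Thm 1 p.262; Theorem p.245; p.244] -/
theorem b14_main_at_record₁₃_of_rOpLeaf (hC : w.C = (datumOfRecord₁₃ F N θ h).C)
    (hV : (leavesP w p).rOperation → ROpLeaf (VOfRecord₁₃ F N θ p))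
    (hT : (leavesP w p).b7 → (leavesP w p).b8 → (leavesP w p).b9 → (leavesP w p).b10 → (leavesP w p).b11 →
      (leavesP w p).smallCouplings → (leavesP w p).smallFieldInductive → (leavesP w p).flowControl →
        ∀ k, k < p.K → SLaw₁₃ F N θ p k → TLaw₁₃ F N θ p k) :
    Dag.B14_main (leavesP w p) :=
  b14_main_at_datumOfTower_of_propTower F N (coreOfRecord₁₃ F N θ) (towerOfRecord₁₃ F N θ h) w p hC
    (SLaw₁₃ F N θ p) (TLaw₁₃ F N θ p) (fun _ _ hS => hS) (fun _ => sLaw₁₃_zero F N θ p) hT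
    (fun hrop => (rOpLeaf_VOfRecord₁₃_iff F N θ p).1 (hV hrop))

/-- **N11 · `Dag.B14_main (leavesP w P)` AT A STAGE-13 WORLD ON THE DEAD-MOVING BRANCH — ONE DISPLAYED SLOT, NO 𝐑-READING HYPOTHESIS**: the (𝐑) step is §2's
THEOREM; the node's `rOperation` antecedent is REDUNDANT here (received, not used). [cite: Balaban1988Convergent, Thm 1 p.262; Theorem p.245; p.244; (2.6) p.255] -/
theorem b14_main_at_record₁₃_of_idem_of_dead (hC : w.C = (datumOfRecord₁₃ F N θ h).C) (hθ : θ.Admissible F N) (hκ : 0 ≤ θ.s2.lf.κ)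
    (hE₀ : 0 ≤ θ.s2.lf.E₀) (hB₀ : 0 ≤ θ.s2.lf.B₀)
    (hidem : ∀ k, k < p.K → ∀ a, θ.ppSel p (gOfRecord₁₃ F N θ p) (k + 1)
      (θ.ppSel p (gOfRecord₁₃ F N θ p) (k + 1) a) = θ.ppSel p (gOfRecord₁₃ F N θ p) (k + 1) a)
    (hdead : ∀ k, k < p.K → ∀ a, θ.ppSel p (gOfRecord₁₃ F N θ p) (k + 1) a ≠ a →
      ∀ V, B15.BasicStep.fibreIntegral (fibOfSeq F θ.ν θ.τ9 p (gOfRecord₁₃ F N θ p) (k + 1) a)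
        (rterm (sliceOfRecord F N θ.ν θ.τ9.M p (gOfRecord₁₃ F N θ p) (k + 1)
          (slotsTOfRecord F N θ.ν θ.τ9 (EOfRecord₁₃ F N θ) (wOfRecord₉ F N θ.toStage9Params) θ.ppSel p (gOfRecord₁₃ F N θ p) (k + 1))) a) V = 0)
    (hT : (leavesP w p).b7 → (leavesP w p).b8 → (leavesP w p).b9 → (leavesP w p).b10 → (leavesP w p).b11 →
      (leavesP w p).smallCouplings → (leavesP w p).smallFieldInductive → (leavesP w p).flowControl →
        ∀ k, k < p.K → SLaw₁₃ F N θ p k → TLaw₁₃ F N θ p k) :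
    Dag.B14_main (leavesP w p) :=
  b14_main_at_record₁₃_of_rOpLeaf F N θ p w h hC (fun _ => rOpLeaf_VOfRecord₁₃_of_idem_of_dead F N θ p h hθ hκ hE₀ hB₀ hidem hdead) hT

/-- **N11 IN THE BINDER SHAPE OF THE ROUTE's K1-class stub** (a world `w` with `IsRecordOfRecord₁₃C F N (datumOfRecord₁₃ F N θ h) w` at an EXPLICIT `(θ, h)`): on the
dead-moving branch the N11 conjunct holds at every run from (S1ᵀ) at `θ`'s objects of record alone (+ the displayed signs) — `construction_eq_of_isRecordOfRecord₁₃C` feeds `hC`.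
[cite: Balaban1988Convergent, Thm 1 p.262; Theorem p.245; p.244 (bookkeeping at the record)] -/
theorem b14_main_of_isRecordOfRecord₁₃C_datum_of_idem_of_dead (hrec : IsRecordOfRecord₁₃C F N (datumOfRecord₁₃ F N θ h) w)
    (hθ : θ.Admissible F N) (hκ : 0 ≤ θ.s2.lf.κ) (hE₀ : 0 ≤ θ.s2.lf.E₀) (hB₀ : 0 ≤ θ.s2.lf.B₀)
    (hidem : ∀ (P : B12.RunParams) (k : ℕ), k < P.K → ∀ a, θ.ppSel P (gOfRecord₁₃ F N θ P) (k + 1)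
      (θ.ppSel P (gOfRecord₁₃ F N θ P) (k + 1) a) = θ.ppSel P (gOfRecord₁₃ F N θ P) (k + 1) a)
    (hdead : ∀ (P : B12.RunParams) (k : ℕ), k < P.K → ∀ a, θ.ppSel P (gOfRecord₁₃ F N θ P) (k + 1) a ≠ a →
      ∀ V, B15.BasicStep.fibreIntegral (fibOfSeq F θ.ν θ.τ9 P (gOfRecord₁₃ F N θ P) (k + 1) a)
        (rterm (sliceOfRecord F N θ.ν θ.τ9.M P (gOfRecord₁₃ F N θ P) (k + 1)
          (slotsTOfRecord F N θ.ν θ.τ9 (EOfRecord₁₃ F N θ) (wOfRecord₉ F N θ.toStage9Params) θ.ppSel P (gOfRecord₁₃ F N θ P) (k + 1))) a) V = 0)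
    (hT : ∀ P : B12.RunParams, (leavesP w P).b7 → (leavesP w P).b8 → (leavesP w P).b9 → (leavesP w P).b10 → (leavesP w P).b11 →
      (leavesP w P).smallCouplings → (leavesP w P).smallFieldInductive → (leavesP w P).flowControl →
        ∀ k, k < P.K → SLaw₁₃ F N θ P k → TLaw₁₃ F N θ P k) (P : B12.RunParams) :
    Dag.B14_main (leavesP w P) :=
  b14_main_at_record₁₃_of_idem_of_dead F N θ P w h (construction_eq_of_isRecordOfRecord₁₃C hrec) hθ hκ hE₀ hB₀ (hidem P) (hdead P) (hT P)

/-- **★ THE (B)-FACE's FIRST CONJUNCT `B16.Thm1Printed (datumOfRecord₁₃ F N θ h).C` FROM THE THEOREM OF p. 245 ALONG THE WINDOWED RUNS ALONE, ON THE DEAD-MOVING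
BRANCH** ([Balaban1989LargeFieldII] Thm 1 p. 355 = [Balaban1988Convergent] Thm 1 p. 262 as the tree states it over the datum's `Sect2Data`): node00-def-T's
`thm1Printed_datumOfRecord₁₃_of_tLaw_rOpLeaf` with the leaf SUPPLIED by §2 along every windowed run.  (S1ᵀ) in law currency (`hT`) displayed; nothing of Sects. 1–3 asserted.
[cite: Balaban1989LargeFieldII, Thm 1 p.355; Balaban1988Convergent, Thm 1 p.262; Theorem p.245; p.244] -/
theorem thm1Printed_datumOfRecord₁₃_of_laws_of_idem_of_dead (hθ : θ.Admissible F N) (hκ : 0 ≤ θ.s2.lf.κ) (hE₀ : 0 ≤ θ.s2.lf.E₀)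
    (hB₀ : 0 ≤ θ.s2.lf.B₀) {γ : ℝ} (hγ : 0 < γ)
    (hidem : ∀ P : B12.RunParams, ((datumOfRecord₁₃ F N θ h).C P).flow.InInterval γ P.K →
      ∀ k, k < P.K → ∀ a, θ.ppSel P (gOfRecord₁₃ F N θ P) (k + 1)
      (θ.ppSel P (gOfRecord₁₃ F N θ P) (k + 1) a) = θ.ppSel P (gOfRecord₁₃ F N θ P) (k + 1) a)
    (hdead : ∀ P : B12.RunParams, ((datumOfRecord₁₃ F N θ h).C P).flow.InInterval γ P.K →
      ∀ k, k < P.K → ∀ a, θ.ppSel P (gOfRecord₁₃ F N θ P) (k + 1) a ≠ a →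
      ∀ V, B15.BasicStep.fibreIntegral (fibOfSeq F θ.ν θ.τ9 P (gOfRecord₁₃ F N θ P) (k + 1) a)
        (rterm (sliceOfRecord F N θ.ν θ.τ9.M P (gOfRecord₁₃ F N θ P) (k + 1)
          (slotsTOfRecord F N θ.ν θ.τ9 (EOfRecord₁₃ F N θ) (wOfRecord₉ F N θ.toStage9Params) θ.ppSel P (gOfRecord₁₃ F N θ P) (k + 1))) a) V = 0)
    (hT : ∀ P : B12.RunParams, ((datumOfRecord₁₃ F N θ h).C P).flow.InInterval γ P.K →
      ∀ k, k < P.K → SLaw₁₃ F N θ P k → TLaw₁₃ F N θ P k) :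
    B16.Thm1Printed (datumOfRecord₁₃ F N θ h).C :=
  thm1Printed_datumOfRecord₁₃_of_tLaw_rOpLeaf F N θ h hγ hT
    (fun P hP => rOpLeaf_VOfRecord₁₃_of_idem_of_dead F N θ P h hθ hκ hE₀ hB₀ (hidem P hP) (hdead P hP))

/-- **`B16.InductionStep` AT THE STAGE-13 DATUM FROM (S1ᵀ) AT THE LIVE SEQUENCES ONLY, dead-moving branch**: along every windowed run, from the per-level hypothesis of
`sLaw₁₃_succ_of_tLawLive_of_idem_of_dead` (𝐓-image laws at every sequence, §2 dichotomy at the sequences with non-zero fibre mass somewhere).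
[cite: Balaban1989LargeFieldII, Thm 1 p.355 and pp.390–391; Balaban1988Convergent, Thm 1 p.262; Theorem p.245; p.244] -/
theorem inductionStep_datumOfRecord₁₃_of_tLawLive_of_idem_of_dead (hθ : θ.Admissible F N) (hκ : 0 ≤ θ.s2.lf.κ) (hE₀ : 0 ≤ θ.s2.lf.E₀)
    (hB₀ : 0 ≤ θ.s2.lf.B₀) (γ : ℝ)
    (hidem : ∀ P : B12.RunParams, ((datumOfRecord₁₃ F N θ h).C P).flow.InInterval γ P.K →
      ∀ k, k < P.K → ∀ a, θ.ppSel P (gOfRecord₁₃ F N θ P) (k + 1)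
      (θ.ppSel P (gOfRecord₁₃ F N θ P) (k + 1) a) = θ.ppSel P (gOfRecord₁₃ F N θ P) (k + 1) a)
    (hdead : ∀ P : B12.RunParams, ((datumOfRecord₁₃ F N θ h).C P).flow.InInterval γ P.K →
      ∀ k, k < P.K → ∀ a, θ.ppSel P (gOfRecord₁₃ F N θ P) (k + 1) a ≠ a →
      ∀ V, B15.BasicStep.fibreIntegral (fibOfSeq F θ.ν θ.τ9 P (gOfRecord₁₃ F N θ P) (k + 1) a)
        (rterm (sliceOfRecord F N θ.ν θ.τ9.M P (gOfRecord₁₃ F N θ P) (k + 1)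
          (slotsTOfRecord F N θ.ν θ.τ9 (EOfRecord₁₃ F N θ) (wOfRecord₉ F N θ.toStage9Params) θ.ppSel P (gOfRecord₁₃ F N θ P) (k + 1))) a) V = 0)
    (hT : ∀ P : B12.RunParams, ((datumOfRecord₁₃ F N θ h).C P).flow.InInterval γ P.K → ∀ k, k < P.K → SLaw₁₃ F N θ P k →
      ∃ (t : SeqOfRecord F θ.ν θ.τ9.M (gOfRecord₁₃ F N θ P) P.K (k + 1) → Sect2.TermValues (F.P P.K) (MatA N) (FluctV N) θ.τ9.M)
      (Ek : SeqOfRecord F θ.ν θ.τ9.M (gOfRecord₁₃ F N θ P) P.K (k + 1) → ℝ), Sect2.UniversalE t ∧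
      ∀ s, Sect2.LawsT (sect2TowerOfRecord F N (FluctV N) P.K (settingOfRecord₁₃ F N θ P) (θ.Rz P.K) s (t s)) (settingOfRecord₁₃ F N θ P).lf
          (settingOfRecord₁₃ F N θ P).βc k ∧
        ((∃ V, B15.BasicStep.fibreIntegral (fibOfSeq F θ.ν θ.τ9 P (gOfRecord₁₃ F N θ P) (k + 1) s)
        (rterm (sliceOfRecord F N θ.ν θ.τ9.M P (gOfRecord₁₃ F N θ P) (k + 1)
          (slotsTOfRecord F N θ.ν θ.τ9 (EOfRecord₁₃ F N θ) (wOfRecord₉ F N θ.toStage9Params) θ.ppSel P (gOfRecord₁₃ F N θ P) (k + 1))) s) V ≠ 0) →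
          (slotsTOfRecord F N θ.ν θ.τ9 (EOfRecord₁₃ F N θ) (wOfRecord₉ F N θ.toStage9Params) θ.ppSel P (gOfRecord₁₃ F N θ P) (k + 1) s = 0 ∨
            ∀ᵐ V ∂(fieldMeasure (F.P P.K) (k + 1) (SU N)), chiSeqOfRecord F N θ.ν θ.τ9.M (gOfRecord₁₃ F N θ P) P.K (k + 1) s V ≠ 0 →
              slotsTOfRecord F N θ.ν θ.τ9 (EOfRecord₁₃ F N θ) (wOfRecord₉ F N θ.toStage9Params) θ.ppSel P (gOfRecord₁₃ F N θ P) (k + 1) s V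
                = sect2Slot F N (FluctV N) P.K (settingOfRecord₁₃ F N θ P) (θ.Rz P.K) (WtOfRecord₁₃ F N θ P) s (t s) (Ek s)
                    (UbgOfRecord₁₃ F N θ P (k + 1) s) V))) :
    B16.InductionStep (datumOfRecord₁₃ F N θ h).C γ := by
  intro P hP k hk hS
  have hS' : SLaw₁₃ F N θ P k := (sLaw₁₃_iff F N θ P k).mpr ((sect2Form_stage13_iff F N θ h P k).mp hS)
  exact (sect2Form_stage13_iff F N θ h P (k + 1)).mpr ((sLaw₁₃_iff F N θ P (k + 1)).mp
    (sLaw₁₃_succ_of_tLawLive_of_idem_of_dead F N θ P h hθ hκ hE₀ hB₀ k hk (hidem P hP k hk) (hdead P hP k hk) (hT P hP k hk hS')))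

/-- **★ THE (B)-FACE's FIRST CONJUNCT `B16.Thm1Printed (datumOfRecord₁₃ F N θ h).C` FROM (S1ᵀ) AT THE LIVE SEQUENCES ONLY, dead-moving branch** (`0 < γ`; base by
node00-def-T's `inductionBase_datumOfRecord₁₃`, step above). [cite: Balaban1989LargeFieldII, Thm 1 p.355 + p.391; Balaban1988Convergent, Thm 1 p.262; Theorem p.245] -/
theorem thm1Printed_datumOfRecord₁₃_of_lawsLive_of_idem_of_dead (hθ : θ.Admissible F N) (hκ : 0 ≤ θ.s2.lf.κ) (hE₀ : 0 ≤ θ.s2.lf.E₀)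
    (hB₀ : 0 ≤ θ.s2.lf.B₀) {γ : ℝ} (hγ : 0 < γ)
    (hidem : ∀ P : B12.RunParams, ((datumOfRecord₁₃ F N θ h).C P).flow.InInterval γ P.K →
      ∀ k, k < P.K → ∀ a, θ.ppSel P (gOfRecord₁₃ F N θ P) (k + 1)
      (θ.ppSel P (gOfRecord₁₃ F N θ P) (k + 1) a) = θ.ppSel P (gOfRecord₁₃ F N θ P) (k + 1) a)
    (hdead : ∀ P : B12.RunParams, ((datumOfRecord₁₃ F N θ h).C P).flow.InInterval γ P.K →
      ∀ k, k < P.K → ∀ a, θ.ppSel P (gOfRecord₁₃ F N θ P) (k + 1) a ≠ a →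
      ∀ V, B15.BasicStep.fibreIntegral (fibOfSeq F θ.ν θ.τ9 P (gOfRecord₁₃ F N θ P) (k + 1) a)
        (rterm (sliceOfRecord F N θ.ν θ.τ9.M P (gOfRecord₁₃ F N θ P) (k + 1)
          (slotsTOfRecord F N θ.ν θ.τ9 (EOfRecord₁₃ F N θ) (wOfRecord₉ F N θ.toStage9Params) θ.ppSel P (gOfRecord₁₃ F N θ P) (k + 1))) a) V = 0)
    (hT : ∀ P : B12.RunParams, ((datumOfRecord₁₃ F N θ h).C P).flow.InInterval γ P.K → ∀ k, k < P.K → SLaw₁₃ F N θ P k →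
      ∃ (t : SeqOfRecord F θ.ν θ.τ9.M (gOfRecord₁₃ F N θ P) P.K (k + 1) → Sect2.TermValues (F.P P.K) (MatA N) (FluctV N) θ.τ9.M)
      (Ek : SeqOfRecord F θ.ν θ.τ9.M (gOfRecord₁₃ F N θ P) P.K (k + 1) → ℝ), Sect2.UniversalE t ∧
      ∀ s, Sect2.LawsT (sect2TowerOfRecord F N (FluctV N) P.K (settingOfRecord₁₃ F N θ P) (θ.Rz P.K) s (t s)) (settingOfRecord₁₃ F N θ P).lf
          (settingOfRecord₁₃ F N θ P).βc k ∧
        ((∃ V, B15.BasicStep.fibreIntegral (fibOfSeq F θ.ν θ.τ9 P (gOfRecord₁₃ F N θ P) (k + 1) s)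
        (rterm (sliceOfRecord F N θ.ν θ.τ9.M P (gOfRecord₁₃ F N θ P) (k + 1)
          (slotsTOfRecord F N θ.ν θ.τ9 (EOfRecord₁₃ F N θ) (wOfRecord₉ F N θ.toStage9Params) θ.ppSel P (gOfRecord₁₃ F N θ P) (k + 1))) s) V ≠ 0) →
          (slotsTOfRecord F N θ.ν θ.τ9 (EOfRecord₁₃ F N θ) (wOfRecord₉ F N θ.toStage9Params) θ.ppSel P (gOfRecord₁₃ F N θ P) (k + 1) s = 0 ∨
            ∀ᵐ V ∂(fieldMeasure (F.P P.K) (k + 1) (SU N)), chiSeqOfRecord F N θ.ν θ.τ9.M (gOfRecord₁₃ F N θ P) P.K (k + 1) s V ≠ 0 →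
              slotsTOfRecord F N θ.ν θ.τ9 (EOfRecord₁₃ F N θ) (wOfRecord₉ F N θ.toStage9Params) θ.ppSel P (gOfRecord₁₃ F N θ P) (k + 1) s V
                = sect2Slot F N (FluctV N) P.K (settingOfRecord₁₃ F N θ P) (θ.Rz P.K) (WtOfRecord₁₃ F N θ P) s (t s) (Ek s)
                    (UbgOfRecord₁₃ F N θ P (k + 1) s) V))) :
    B16.Thm1Printed (datumOfRecord₁₃ F N θ h).C :=
  B16.thm1_of_steps _ γ hγ (inductionBase_datumOfRecord₁₃ F N θ h γ)
    (inductionStep_datumOfRecord₁₃_of_tLawLive_of_idem_of_dead F N θ h hθ hκ hE₀ hB₀ γ hidem hdead hT)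

end Junction

/-! ## §5  ★ 𝐑 OF RECORD IS THE IDENTITY ALMOST EVERYWHERE ON THE DEAD-MOVING BRANCH, Stage 13: `ρ_{k+1} = 𝐓ρ_k` a.e. under the integrable-form `rstep` -/

section IdentityAERecord

variable (θ : Stage13Params F N) (p : B12.RunParams)

/-- **★ AT THE STAGE-13 RECORD, `ρ_{k+1} = 𝐓ρ_k` ALMOST EVERYWHERE ON THE DEAD-MOVING BRANCH** (`k < K`; `Provisos₁₃.rstep` = def-R's integrable-form (0.3) provisos of the
pre-𝐑 tower; the level-`k+1` selector idempotent and moving only dead sequences): `densOfRecord₁₃ θ p (k+1) = Σ_{s′} χ_{k+1}(s′)·slot_{k+1}(s′)` and `tdensOfRecord₁₃ θ p k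
= Σ_{s′} χ_{k+1}(s′)·slotT_{k+1}(s′)` agree a.e. — per sequence: fixed points a.e. on the support (§1), moved sequences `0 = t_{s′}` a.e. (§1 off-range + def-R's
`ae_eq_zero_of_self_or_fibreIntegral_eq_zero`: an integrable, a.e.-non-negative DEAD piece vanishes a.e.).  On this branch 𝐑 OF RECORD CHANGES NO DENSITY OF THE RUN
BEYOND A NULL SET. [cite: Balaban1989LargeFieldI, (0.2)–(0.4) p.176, p.177 (i)–(ii); Balaban1988Convergent, (2.18) p.257, Thm 1 p.262, (3.24)–(3.25) p.270; Balaban1989LargeFieldII, Thm 1 p.355 (not exercised)] -/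
theorem densOfRecord₁₃_succ_ae_eq_tdens_of_idem_of_dead (h : θ.Provisos₁₃ F N) (k : ℕ) (hk : k < p.K)
    (hidem : ∀ a, θ.ppSel p (gOfRecord₁₃ F N θ p) (k + 1) (θ.ppSel p (gOfRecord₁₃ F N θ p) (k + 1) a) = θ.ppSel p (gOfRecord₁₃ F N θ p) (k + 1) a)
    (hdead : ∀ a, θ.ppSel p (gOfRecord₁₃ F N θ p) (k + 1) a ≠ a →
      ∀ V, B15.BasicStep.fibreIntegral (fibOfSeq F θ.ν θ.τ9 p (gOfRecord₁₃ F N θ p) (k + 1) a)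
        (rterm (sliceOfRecord F N θ.ν θ.τ9.M p (gOfRecord₁₃ F N θ p) (k + 1)
          (slotsTOfRecord F N θ.ν θ.τ9 (EOfRecord₁₃ F N θ) (wOfRecord₉ F N θ.toStage9Params) θ.ppSel p (gOfRecord₁₃ F N θ p) (k + 1))) a) V = 0) :
    densOfRecord₁₃ F N θ p (k + 1) =ᵐ[fieldMeasure (F.P p.K) (k + 1) (SU N)] tdensOfRecord₁₃ F N θ p k := by
  have HP := h.rstep p k hk
  have hs : ∀ s, ∀ᵐ V ∂(fieldMeasure (F.P p.K) (k + 1) (SU N)),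
      chiSeqOfRecord F N θ.ν θ.τ9.M (gOfRecord₁₃ F N θ p) p.K (k + 1) s V *
          slotsOfRecord F N θ.ν θ.τ9 (EOfRecord₁₃ F N θ) (wOfRecord₉ F N θ.toStage9Params) θ.ppSel p (gOfRecord₁₃ F N θ p) (k + 1) s V
        = chiSeqOfRecord F N θ.ν θ.τ9.M (gOfRecord₁₃ F N θ p) p.K (k + 1) s V *
          slotsTOfRecord F N θ.ν θ.τ9 (EOfRecord₁₃ F N θ) (wOfRecord₉ F N θ.toStage9Params) θ.ppSel p (gOfRecord₁₃ F N θ p) (k + 1) s V := by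
    intro s
    by_cases hfix : θ.ppSel p (gOfRecord₁₃ F N θ p) (k + 1) s = s
    · filter_upwards [slotsOfRecord₁₃_succ_ae_eq_slotsT_of_fix_of_dead F N θ p h k hk s hfix
        (fun a ha hne => hdead a fun heq => hne (heq.symm.trans ha))] with V hV
      by_cases hχ : chiSeqOfRecord F N θ.ν θ.τ9.M (gOfRecord₁₃ F N θ p) p.K (k + 1) s V = 0
      · rw [hχ, zero_mul, zero_mul]
      · rw [hV hχ]
    · have hnr : s ∉ Set.range (θ.ppSel p (gOfRecord₁₃ F N θ p) (k + 1)) := not_mem_range_of_idem_of_ne hidem hfix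
      have hz := slotsOfRecord₁₃_succ_eq_zero_of_not_mem_range F N θ p k s hnr
      have hi : Integrable (fun V => chiSeqOfRecord F N θ.ν θ.τ9.M (gOfRecord₁₃ F N θ p) p.K (k + 1) s V *
          slotsTOfRecord F N θ.ν θ.τ9 (EOfRecord₁₃ F N θ) (wOfRecord₉ F N θ.toStage9Params) θ.ppSel p (gOfRecord₁₃ F N θ p) (k + 1) s V)
          (fieldMeasure (F.P p.K) (k + 1) (SU N)) := HP.1 s
      have h0 : ∀ᵐ V ∂(fieldMeasure (F.P p.K) (k + 1) (SU N)), 0 ≤ chiSeqOfRecord F N θ.ν θ.τ9.M (gOfRecord₁₃ F N θ p) p.K (k + 1) s V *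
          slotsTOfRecord F N θ.ν θ.τ9 (EOfRecord₁₃ F N θ) (wOfRecord₉ F N θ.toStage9Params) θ.ppSel p (gOfRecord₁₃ F N θ p) (k + 1) s V := HP.2.1 s
      have hae := B15.BasicStep.ae_eq_zero_of_self_or_fibreIntegral_eq_zero
        (fibOfSeq F θ.ν θ.τ9 p (gOfRecord₁₃ F N θ p) (k + 1) s) hi h0 (fun V => Or.inr (by
          have H := hdead s hfix V
          convert H using 2
          rfl))
      filter_upwards [hae] with V hV
      have hV' : chiSeqOfRecord F N θ.ν θ.τ9.M (gOfRecord₁₃ F N θ p) p.K (k + 1) s V *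
          slotsTOfRecord F N θ.ν θ.τ9 (EOfRecord₁₃ F N θ) (wOfRecord₉ F N θ.toStage9Params) θ.ppSel p (gOfRecord₁₃ F N θ p) (k + 1) s V = 0 := hV
      rw [hz, Pi.zero_apply, mul_zero, hV']
  have hall := ae_all_iff.2 hs
  filter_upwards [hall] with V hV
  exact Finset.sum_congr rfl fun s _ => hV s

end IdentityAERecord

/-! ## §6  ★ AT THE LIVE SELECTOR CLAUSE `hsel : θ.ppSel = ppSelLiveOfRecord … (EOfRecord₁₃ θ) …` (node00-def-T's §4c binder; `rfl` at K0a's `θ.liveRepin₁₃` and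
`theta13LiveOfRecord`): idempotency and «moved ⇒ dead» DISCHARGED — the leaf from the provisos alone, (S1ᵀ) only at the live sequences, the node, the (B)-face
conjunct, 𝐑 = identity a.e. -/

section LiveSel

variable (θ : Stage13Params F N)

/-- **THE LIVE SELECTOR OF RECORD IS IDEMPOTENT AT EVERY POSITIVE LEVEL** — read at a `θ` carrying the selector clause. [cite: Balaban1989LargeFieldI, (0.3) p.176, p.177 (`Z″″ = Z″`, bookkeeping)] -/
theorem ppSel_succ_idem_of_liveSel
    (hsel : θ.ppSel = ppSelLiveOfRecord F N θ.ν θ.τ9 (EOfRecord₁₃ F N θ) (wOfRecord₉ F N θ.toStage9Params)) (p : B12.RunParams) (k : ℕ)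
    (a : SeqOfRecord F θ.ν θ.τ9.M (gOfRecord₁₃ F N θ p) p.K (k + 1)) :
    θ.ppSel p (gOfRecord₁₃ F N θ p) (k + 1) (θ.ppSel p (gOfRecord₁₃ F N θ p) (k + 1) a) = θ.ppSel p (gOfRecord₁₃ F N θ p) (k + 1) a := by
  rw [hsel]
  exact ppSelLiveOfRecord_succ_idem θ.ν θ.τ9 (EOfRecord₁₃ F N θ) (wOfRecord₉ F N θ.toStage9Params) p (gOfRecord₁₃ F N θ p) k a

/-- **THE LIVE SELECTOR OF RECORD MOVES ONLY DEAD SEQUENCES of the pre-𝐑 family of record at the same level** — read at a `θ` carrying the selector clause.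
[cite: Balaban1989LargeFieldI, (0.3) p.176, p.177 (i)–(ii); Balaban1988Convergent, (3.24)–(3.25) p.270] -/
theorem dead_of_ppSel_succ_ne_of_liveSel
    (hsel : θ.ppSel = ppSelLiveOfRecord F N θ.ν θ.τ9 (EOfRecord₁₃ F N θ) (wOfRecord₉ F N θ.toStage9Params)) (p : B12.RunParams) (k : ℕ)
    (a : SeqOfRecord F θ.ν θ.τ9.M (gOfRecord₁₃ F N θ p) p.K (k + 1)) (hne : θ.ppSel p (gOfRecord₁₃ F N θ p) (k + 1) a ≠ a)
    (V : GaugeField (F.P p.K) (k + 1) (SU N)) :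
    B15.BasicStep.fibreIntegral (fibOfSeq F θ.ν θ.τ9 p (gOfRecord₁₃ F N θ p) (k + 1) a)
        (rterm (sliceOfRecord F N θ.ν θ.τ9.M p (gOfRecord₁₃ F N θ p) (k + 1)
          (slotsTOfRecord F N θ.ν θ.τ9 (EOfRecord₁₃ F N θ) (wOfRecord₉ F N θ.toStage9Params) θ.ppSel p (gOfRecord₁₃ F N θ p) (k + 1))) a) V = 0 := by
  revert hne
  rw [hsel]
  intro hne
  exact dead_of_ppSelLiveOfRecord_succ_ne θ.ν θ.τ9 (EOfRecord₁₃ F N θ) (wOfRecord₉ F N θ.toStage9Params) p (gOfRecord₁₃ F N θ p) k hne V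

/-- **AT THE LIVE SELECTOR, A NON-LIVE SEQUENCE IS ABSENT FROM `ρ_{k+1}`** (node00-def-K0a's currency `¬ LiveSeq … (slotT_{k+1}) s ⇒ slot_{k+1}(s) = 0`), NO proviso.
[cite: Balaban1989LargeFieldI, (0.3) p.176, p.177 (i)–(ii); Balaban1988Convergent, (2.17)–(2.18) p.257] -/
theorem slotsOfRecord₁₃_succ_eq_zero_of_not_liveSeq_of_liveSel
    (hsel : θ.ppSel = ppSelLiveOfRecord F N θ.ν θ.τ9 (EOfRecord₁₃ F N θ) (wOfRecord₉ F N θ.toStage9Params)) (p : B12.RunParams) (k : ℕ)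
    (s : SeqOfRecord F θ.ν θ.τ9.M (gOfRecord₁₃ F N θ p) p.K (k + 1))
    (hs : ¬ LiveSeq F N θ.ν θ.τ9 p (gOfRecord₁₃ F N θ p) (k + 1)
      (slotsTOfRecord F N θ.ν θ.τ9 (EOfRecord₁₃ F N θ) (wOfRecord₉ F N θ.toStage9Params) θ.ppSel p (gOfRecord₁₃ F N θ p) (k + 1)) s) :
    slotsOfRecord F N θ.ν θ.τ9 (EOfRecord₁₃ F N θ) (wOfRecord₉ F N θ.toStage9Params) θ.ppSel p (gOfRecord₁₃ F N θ p) (k + 1) s = 0 :=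
  slotsOfRecord₁₃_succ_eq_zero_of_dead F N θ p k (ppSel_succ_idem_of_liveSel F N θ hsel p k)
    (fun a hne V => dead_of_ppSel_succ_ne_of_liveSel F N θ hsel p k a hne V) s (dead_of_not_liveSeq _ hs)

variable (p : B12.RunParams)

/-- **★ THE 𝐑-LEAF OF RECORD AT STAGE 13 AT THE LIVE SELECTOR, FROM THE PROVISOS, ADMISSIBILITY AND THE TERM-CONSTANT SIGNS ALONE** — N13's conjunct on the live line
costs exactly K0″'s own residual `Provisos₁₃` (+ `0 ≤ κ, E₀, B₀`, discharged by numerals at any concrete witness). [cite: Balaban1988Convergent, p.244, Thm 2 p.263; Balaban1989LargeFieldI, (0.3) p.176, p.177 (i)–(ii); Balaban1989LargeFieldII, Thm 1 p.355 (not exercised)] -/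
theorem rOpLeaf_VOfRecord₁₃_of_liveSel (h : θ.Provisos₁₃ F N) (hθ : θ.Admissible F N) (hκ : 0 ≤ θ.s2.lf.κ) (hE₀ : 0 ≤ θ.s2.lf.E₀) (hB₀ : 0 ≤ θ.s2.lf.B₀)
    (hsel : θ.ppSel = ppSelLiveOfRecord F N θ.ν θ.τ9 (EOfRecord₁₃ F N θ) (wOfRecord₉ F N θ.toStage9Params)) :
    ROpLeaf (VOfRecord₁₃ F N θ p) :=
  rOpLeaf_VOfRecord₁₃_of_idem_of_dead F N θ p h hθ hκ hE₀ hB₀ (fun k _ => ppSel_succ_idem_of_liveSel F N θ hsel p k)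
    (fun k _ a hne V => dead_of_ppSel_succ_ne_of_liveSel F N θ hsel p k a hne V)

/-- **The leaf IN LAW FORM at the live selector** — the (R₁₃) slot `∀ k < K, TLaw₁₃ θ p k → SLaw₁₃ θ p (k+1)` of n24-c's `nodes_N11_N13_at_record₁₃` SUPPLIED on the live
line from the provisos alone. [cite: Balaban1988Convergent, p.244 (bookkeeping); Balaban1989LargeFieldII, Thm 1 p.355 (not exercised)] -/
theorem laws₁₃_of_liveSel (h : θ.Provisos₁₃ F N) (hθ : θ.Admissible F N) (hκ : 0 ≤ θ.s2.lf.κ) (hE₀ : 0 ≤ θ.s2.lf.E₀) (hB₀ : 0 ≤ θ.s2.lf.B₀)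
    (hsel : θ.ppSel = ppSelLiveOfRecord F N θ.ν θ.τ9 (EOfRecord₁₃ F N θ) (wOfRecord₉ F N θ.toStage9Params)) :
    ∀ k, k < p.K → TLaw₁₃ F N θ p k → SLaw₁₃ F N θ p (k + 1) :=
  (rOpLeaf_VOfRecord₁₃_iff F N θ p).mp (rOpLeaf_VOfRecord₁₃_of_liveSel F N θ p h hθ hκ hE₀ hB₀ hsel)

/-- **THE RUN's `rOperation` LEAF READS TRUE at a world bound to the C-binding of record over the Stage-13 view, at the live selector.**
[cite: Balaban1988Convergent, p.244; Balaban1989LargeFieldII, Thm 1 p.355 (bookkeeping at the record)] -/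
theorem rOperation_leavesP_of_liveSel₁₃ (w : WorldP) (hup : w.up p = upOfRecord₅C F N (θ.toStage5₁₃ F N) p) (h : θ.Provisos₁₃ F N)
    (hθ : θ.Admissible F N) (hκ : 0 ≤ θ.s2.lf.κ) (hE₀ : 0 ≤ θ.s2.lf.E₀) (hB₀ : 0 ≤ θ.s2.lf.B₀)
    (hsel : θ.ppSel = ppSelLiveOfRecord F N θ.ν θ.τ9 (EOfRecord₁₃ F N θ) (wOfRecord₉ F N θ.toStage9Params)) :
    (leavesP w p).rOperation :=
  rOperation_leavesP_of_idem_of_dead₁₃ F N θ p w hup h hθ hκ hE₀ hB₀ (fun k _ => ppSel_succ_idem_of_liveSel F N θ hsel p k)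
    (fun k _ a hne V => dead_of_ppSel_succ_ne_of_liveSel F N θ hsel p k a hne V)

/-- **★ AT THE LIVE SELECTOR: `TLaw` AT THE LIVE SEQUENCES ONLY ⇒ `SLaw₁₃ (k+1)`** (K0a's `LiveSeq` currency: the §2 dichotomy of `𝐓ρ_k`'s slots is demanded only where
`LiveSeq` holds; the laws `Sect2.LawsT … k` at every sequence; signs displayed).  This is N11's per-level share of Theorem 1 on the witness line.
[cite: Balaban1988Convergent, §2 p.262, Thm 2 p.263, (3.24)–(3.25) p.270; Balaban1989LargeFieldI, (0.3) p.176, p.177 (i)–(ii)] -/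
theorem sLaw₁₃_succ_of_tLawLiveSeq_of_liveSel (h : θ.Provisos₁₃ F N) (hθ : θ.Admissible F N) (hκ : 0 ≤ θ.s2.lf.κ) (hE₀ : 0 ≤ θ.s2.lf.E₀)
    (hB₀ : 0 ≤ θ.s2.lf.B₀)
    (hsel : θ.ppSel = ppSelLiveOfRecord F N θ.ν θ.τ9 (EOfRecord₁₃ F N θ) (wOfRecord₉ F N θ.toStage9Params)) (k : ℕ) (hk : k < p.K)
    (hT : ∃ (t : SeqOfRecord F θ.ν θ.τ9.M (gOfRecord₁₃ F N θ p) p.K (k + 1) → Sect2.TermValues (F.P p.K) (MatA N) (FluctV N) θ.τ9.M)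
      (Ek : SeqOfRecord F θ.ν θ.τ9.M (gOfRecord₁₃ F N θ p) p.K (k + 1) → ℝ), Sect2.UniversalE t ∧
      ∀ s, Sect2.LawsT (sect2TowerOfRecord F N (FluctV N) p.K (settingOfRecord₁₃ F N θ p) (θ.Rz p.K) s (t s)) (settingOfRecord₁₃ F N θ p).lf
          (settingOfRecord₁₃ F N θ p).βc k ∧
        (LiveSeq F N θ.ν θ.τ9 p (gOfRecord₁₃ F N θ p) (k + 1)
            (slotsTOfRecord F N θ.ν θ.τ9 (EOfRecord₁₃ F N θ) (wOfRecord₉ F N θ.toStage9Params) θ.ppSel p (gOfRecord₁₃ F N θ p) (k + 1)) s →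
          (slotsTOfRecord F N θ.ν θ.τ9 (EOfRecord₁₃ F N θ) (wOfRecord₉ F N θ.toStage9Params) θ.ppSel p (gOfRecord₁₃ F N θ p) (k + 1) s = 0 ∨
            ∀ᵐ V ∂(fieldMeasure (F.P p.K) (k + 1) (SU N)), chiSeqOfRecord F N θ.ν θ.τ9.M (gOfRecord₁₃ F N θ p) p.K (k + 1) s V ≠ 0 →
              slotsTOfRecord F N θ.ν θ.τ9 (EOfRecord₁₃ F N θ) (wOfRecord₉ F N θ.toStage9Params) θ.ppSel p (gOfRecord₁₃ F N θ p) (k + 1) s V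
                = sect2Slot F N (FluctV N) p.K (settingOfRecord₁₃ F N θ p) (θ.Rz p.K) (WtOfRecord₁₃ F N θ p) s (t s) (Ek s)
                    (UbgOfRecord₁₃ F N θ p (k + 1) s) V))) :
    SLaw₁₃ F N θ p (k + 1) := by
  obtain ⟨t, Ek, hu, hs⟩ := hT
  refine sLaw₁₃_succ_of_tLawLive_of_idem_of_dead F N θ p h hθ hκ hE₀ hB₀ k hk (ppSel_succ_idem_of_liveSel F N θ hsel p k)
    (fun a hne V => dead_of_ppSel_succ_ne_of_liveSel F N θ hsel p k a hne V)
    ⟨t, Ek, hu, fun s => ⟨(hs s).1, fun ⟨V, hV⟩ => (hs s).2 ?_⟩⟩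
  obtain ⟨W, hf, hI⟩ := exists_live_of_fibreIntegral_rterm_ne_zero
    (sliceOfRecord F N θ.ν θ.τ9.M p (gOfRecord₁₃ F N θ p) (k + 1)
      (slotsTOfRecord F N θ.ν θ.τ9 (EOfRecord₁₃ F N θ) (wOfRecord₉ F N θ.toStage9Params) θ.ppSel p (gOfRecord₁₃ F N θ p) (k + 1)))
    (fibOfSeq F θ.ν θ.τ9 p (gOfRecord₁₃ F N θ p) (k + 1)) s V hV
  exact liveSeq_of_ne_zero F N _ hf hI

/-- **★ THEOREM 1 [III] AT THE STAGE-13 OBJECTS OF RECORD AT THE LIVE SELECTOR, FROM (S1ᵀ) AT THE LIVE SEQUENCES ONLY**: `∀ k ≤ K, SLaw₁₃ θ p k` from «`SLaw₁₃ θ p k ⇒`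
the 𝐓-image laws at every sequence + the §2 dichotomy at the `LiveSeq` sequences of `𝐓ρ_k`», `k < K` (induction from node00-def-T's start `sLaw₁₃_zero`).
[cite: Balaban1988Convergent, Thm 1 p.262; Theorem p.245; p.244; Balaban1989LargeFieldI, (0.3) p.176, p.177 (i)–(ii)] -/
theorem sLaw₁₃_all_of_thmP245LiveSeq_of_liveSel (h : θ.Provisos₁₃ F N) (hθ : θ.Admissible F N) (hκ : 0 ≤ θ.s2.lf.κ) (hE₀ : 0 ≤ θ.s2.lf.E₀)
    (hB₀ : 0 ≤ θ.s2.lf.B₀)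
    (hsel : θ.ppSel = ppSelLiveOfRecord F N θ.ν θ.τ9 (EOfRecord₁₃ F N θ) (wOfRecord₉ F N θ.toStage9Params))
    (hT : ∀ k, k < p.K → SLaw₁₃ F N θ p k →
      ∃ (t : SeqOfRecord F θ.ν θ.τ9.M (gOfRecord₁₃ F N θ p) p.K (k + 1) → Sect2.TermValues (F.P p.K) (MatA N) (FluctV N) θ.τ9.M)
      (Ek : SeqOfRecord F θ.ν θ.τ9.M (gOfRecord₁₃ F N θ p) p.K (k + 1) → ℝ), Sect2.UniversalE t ∧
      ∀ s, Sect2.LawsT (sect2TowerOfRecord F N (FluctV N) p.K (settingOfRecord₁₃ F N θ p) (θ.Rz p.K) s (t s)) (settingOfRecord₁₃ F N θ p).lf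
          (settingOfRecord₁₃ F N θ p).βc k ∧
        (LiveSeq F N θ.ν θ.τ9 p (gOfRecord₁₃ F N θ p) (k + 1)
            (slotsTOfRecord F N θ.ν θ.τ9 (EOfRecord₁₃ F N θ) (wOfRecord₉ F N θ.toStage9Params) θ.ppSel p (gOfRecord₁₃ F N θ p) (k + 1)) s →
          (slotsTOfRecord F N θ.ν θ.τ9 (EOfRecord₁₃ F N θ) (wOfRecord₉ F N θ.toStage9Params) θ.ppSel p (gOfRecord₁₃ F N θ p) (k + 1) s = 0 ∨
            ∀ᵐ V ∂(fieldMeasure (F.P p.K) (k + 1) (SU N)), chiSeqOfRecord F N θ.ν θ.τ9.M (gOfRecord₁₃ F N θ p) p.K (k + 1) s V ≠ 0 →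
              slotsTOfRecord F N θ.ν θ.τ9 (EOfRecord₁₃ F N θ) (wOfRecord₉ F N θ.toStage9Params) θ.ppSel p (gOfRecord₁₃ F N θ p) (k + 1) s V
                = sect2Slot F N (FluctV N) p.K (settingOfRecord₁₃ F N θ p) (θ.Rz p.K) (WtOfRecord₁₃ F N θ p) s (t s) (Ek s)
                    (UbgOfRecord₁₃ F N θ p (k + 1) s) V))) :
    ∀ k, k ≤ p.K → SLaw₁₃ F N θ p k := by
  intro k
  induction k with
  | zero => exact fun _ => sLaw₁₃_zero F N θ p
  | succ n ih =>
    intro hk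
    exact sLaw₁₃_succ_of_tLawLiveSeq_of_liveSel F N θ p h hθ hκ hE₀ hB₀ hsel n (Nat.lt_of_succ_le hk)
      (hT n (Nat.lt_of_succ_le hk) (ih (Nat.le_of_succ_le hk)))

/-- **THEOREM 1 [III] AT THE LIVE SELECTOR FROM THE FULL (S1ᵀ)** (the Theorem of p. 245 at the objects of record, law reading `SLaw₁₃ k → TLaw₁₃ k`).
[cite: Balaban1988Convergent, Thm 1 p.262; Theorem p.245; p.244] -/
theorem sLaw₁₃_all_of_thmP245_of_liveSel (h : θ.Provisos₁₃ F N) (hθ : θ.Admissible F N) (hκ : 0 ≤ θ.s2.lf.κ) (hE₀ : 0 ≤ θ.s2.lf.E₀) (hB₀ : 0 ≤ θ.s2.lf.B₀)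
    (hsel : θ.ppSel = ppSelLiveOfRecord F N θ.ν θ.τ9 (EOfRecord₁₃ F N θ) (wOfRecord₉ F N θ.toStage9Params))
    (hT : ∀ k, k < p.K → SLaw₁₃ F N θ p k → TLaw₁₃ F N θ p k) :
    ∀ k, k ≤ p.K → SLaw₁₃ F N θ p k :=
  sLaw₁₃_all_of_laws F N θ p (laws₁₃_of_liveSel F N θ p h hθ hκ hE₀ hB₀ hsel) hT

variable (w : WorldP) (h : θ.Provisos₁₃ F N)

/-- **N11 · `Dag.B14_main (leavesP w P)` AT A STAGE-13 WORLD AT THE LIVE SELECTOR — ONE DISPLAYED SLOT (S1ᵀ), NO 𝐑-READING HYPOTHESIS.**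
[cite: Balaban1988Convergent, Thm 1 p.262; Theorem p.245; p.244; (2.6) p.255] -/
theorem b14_main_at_record₁₃_of_liveSel (hC : w.C = (datumOfRecord₁₃ F N θ h).C) (hθ : θ.Admissible F N) (hκ : 0 ≤ θ.s2.lf.κ) (hE₀ : 0 ≤ θ.s2.lf.E₀)
    (hB₀ : 0 ≤ θ.s2.lf.B₀)
    (hsel : θ.ppSel = ppSelLiveOfRecord F N θ.ν θ.τ9 (EOfRecord₁₃ F N θ) (wOfRecord₉ F N θ.toStage9Params))
    (hT : (leavesP w p).b7 → (leavesP w p).b8 → (leavesP w p).b9 → (leavesP w p).b10 → (leavesP w p).b11 →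
      (leavesP w p).smallCouplings → (leavesP w p).smallFieldInductive → (leavesP w p).flowControl →
        ∀ k, k < p.K → SLaw₁₃ F N θ p k → TLaw₁₃ F N θ p k) :
    Dag.B14_main (leavesP w p) :=
  b14_main_at_record₁₃_of_rOpLeaf F N θ p w h hC (fun _ => rOpLeaf_VOfRecord₁₃_of_liveSel F N θ p h hθ hκ hE₀ hB₀ hsel) hT

/-- **N11 · `Dag.B14_main (leavesP w P)` AT THE LIVE SELECTOR FROM (S1ᵀ) AT THE LIVE SEQUENCES ONLY** (K0a's `LiveSeq` currency; the node's interval antecedent is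
received but not needed — `0 ≤ g_{k+1}` is free, §0). [cite: Balaban1988Convergent, Thm 1 p.262; Theorem p.245; (2.6) p.255; Balaban1989LargeFieldI, (0.3) p.176, p.177 (i)–(ii)] -/
theorem b14_main_at_record₁₃_of_lawsLive_of_liveSel (hC : w.C = (datumOfRecord₁₃ F N θ h).C) (hθ : θ.Admissible F N) (hκ : 0 ≤ θ.s2.lf.κ)
    (hE₀ : 0 ≤ θ.s2.lf.E₀) (hB₀ : 0 ≤ θ.s2.lf.B₀)
    (hsel : θ.ppSel = ppSelLiveOfRecord F N θ.ν θ.τ9 (EOfRecord₁₃ F N θ) (wOfRecord₉ F N θ.toStage9Params))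
    (hT : (leavesP w p).b7 → (leavesP w p).b8 → (leavesP w p).b9 → (leavesP w p).b10 → (leavesP w p).b11 →
      (leavesP w p).smallCouplings → (leavesP w p).smallFieldInductive → (leavesP w p).flowControl →
      ∀ k, k < p.K → SLaw₁₃ F N θ p k →
      ∃ (t : SeqOfRecord F θ.ν θ.τ9.M (gOfRecord₁₃ F N θ p) p.K (k + 1) → Sect2.TermValues (F.P p.K) (MatA N) (FluctV N) θ.τ9.M)
      (Ek : SeqOfRecord F θ.ν θ.τ9.M (gOfRecord₁₃ F N θ p) p.K (k + 1) → ℝ), Sect2.UniversalE t ∧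
      ∀ s, Sect2.LawsT (sect2TowerOfRecord F N (FluctV N) p.K (settingOfRecord₁₃ F N θ p) (θ.Rz p.K) s (t s)) (settingOfRecord₁₃ F N θ p).lf
          (settingOfRecord₁₃ F N θ p).βc k ∧
        (LiveSeq F N θ.ν θ.τ9 p (gOfRecord₁₃ F N θ p) (k + 1)
            (slotsTOfRecord F N θ.ν θ.τ9 (EOfRecord₁₃ F N θ) (wOfRecord₉ F N θ.toStage9Params) θ.ppSel p (gOfRecord₁₃ F N θ p) (k + 1)) s →
          (slotsTOfRecord F N θ.ν θ.τ9 (EOfRecord₁₃ F N θ) (wOfRecord₉ F N θ.toStage9Params) θ.ppSel p (gOfRecord₁₃ F N θ p) (k + 1) s = 0 ∨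
            ∀ᵐ V ∂(fieldMeasure (F.P p.K) (k + 1) (SU N)), chiSeqOfRecord F N θ.ν θ.τ9.M (gOfRecord₁₃ F N θ p) p.K (k + 1) s V ≠ 0 →
              slotsTOfRecord F N θ.ν θ.τ9 (EOfRecord₁₃ F N θ) (wOfRecord₉ F N θ.toStage9Params) θ.ppSel p (gOfRecord₁₃ F N θ p) (k + 1) s V
                = sect2Slot F N (FluctV N) p.K (settingOfRecord₁₃ F N θ p) (θ.Rz p.K) (WtOfRecord₁₃ F N θ p) s (t s) (Ek s)
                    (UbgOfRecord₁₃ F N θ p (k + 1) s) V))) :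
    Dag.B14_main (leavesP w p) := by
  intro h7 h8 h9 h10 h11 hsf hfc _ hsc
  exact (densitiesDescribed_iff_core F N (coreOfRecord₁₃ F N θ) (towerOfRecord₁₃ F N θ h) w p hC).2
    (sLaw₁₃_all_of_thmP245LiveSeq_of_liveSel F N θ p h hθ hκ hE₀ hB₀ hsel (hT h7 h8 h9 h10 h11 hsc (hsf hsc) (hfc hsc)))

/-- **N11 in the K1-class binder shape at the live selector** (world with `IsRecordOfRecord₁₃C F N (datumOfRecord₁₃ F N θ h) w`, full (S1ᵀ) per run).
[cite: Balaban1988Convergent, Thm 1 p.262; Theorem p.245; p.244 (bookkeeping at the record)] -/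
theorem b14_main_of_isRecordOfRecord₁₃C_datum_of_liveSel (hrec : IsRecordOfRecord₁₃C F N (datumOfRecord₁₃ F N θ h) w) (hθ : θ.Admissible F N)
    (hκ : 0 ≤ θ.s2.lf.κ) (hE₀ : 0 ≤ θ.s2.lf.E₀) (hB₀ : 0 ≤ θ.s2.lf.B₀)
    (hsel : θ.ppSel = ppSelLiveOfRecord F N θ.ν θ.τ9 (EOfRecord₁₃ F N θ) (wOfRecord₉ F N θ.toStage9Params))
    (hT : ∀ P : B12.RunParams, (leavesP w P).b7 → (leavesP w P).b8 → (leavesP w P).b9 → (leavesP w P).b10 → (leavesP w P).b11 →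
      (leavesP w P).smallCouplings → (leavesP w P).smallFieldInductive → (leavesP w P).flowControl →
        ∀ k, k < P.K → SLaw₁₃ F N θ P k → TLaw₁₃ F N θ P k) (P : B12.RunParams) :
    Dag.B14_main (leavesP w P) :=
  b14_main_at_record₁₃_of_liveSel F N θ P w h (construction_eq_of_isRecordOfRecord₁₃C hrec) hθ hκ hE₀ hB₀ hsel (hT P)

/-- **★ THE (B)-FACE's FIRST CONJUNCT `B16.Thm1Printed (datumOfRecord₁₃ F N θ h).C` AT THE LIVE SELECTOR FROM THE FULL (S1ᵀ) along the windowed runs** (leaf SUPPLIED).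
[cite: Balaban1989LargeFieldII, Thm 1 p.355; Balaban1988Convergent, Thm 1 p.262; Theorem p.245; p.244] -/
theorem thm1Printed_datumOfRecord₁₃_of_laws_of_liveSel (hθ : θ.Admissible F N) (hκ : 0 ≤ θ.s2.lf.κ) (hE₀ : 0 ≤ θ.s2.lf.E₀) (hB₀ : 0 ≤ θ.s2.lf.B₀)
    (hsel : θ.ppSel = ppSelLiveOfRecord F N θ.ν θ.τ9 (EOfRecord₁₃ F N θ) (wOfRecord₉ F N θ.toStage9Params)) {γ : ℝ} (hγ : 0 < γ)
    (hT : ∀ P : B12.RunParams, ((datumOfRecord₁₃ F N θ h).C P).flow.InInterval γ P.K →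
      ∀ k, k < P.K → SLaw₁₃ F N θ P k → TLaw₁₃ F N θ P k) :
    B16.Thm1Printed (datumOfRecord₁₃ F N θ h).C :=
  thm1Printed_datumOfRecord₁₃_of_tLaw_rOpLeaf F N θ h hγ hT (fun P _ => rOpLeaf_VOfRecord₁₃_of_liveSel F N θ P h hθ hκ hE₀ hB₀ hsel)

/-- **★ THE (B)-FACE's FIRST CONJUNCT AT THE LIVE SELECTOR FROM (S1ᵀ) AT THE LIVE SEQUENCES ONLY** (K0a's `LiveSeq` currency, along the windowed runs; `0 < γ`).
[cite: Balaban1989LargeFieldII, Thm 1 p.355 + p.391; Balaban1988Convergent, Thm 1 p.262; Theorem p.245; Balaban1989LargeFieldI, (0.3) p.176, p.177 (i)–(ii)] -/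
theorem thm1Printed_datumOfRecord₁₃_of_lawsLive_of_liveSel (hθ : θ.Admissible F N) (hκ : 0 ≤ θ.s2.lf.κ) (hE₀ : 0 ≤ θ.s2.lf.E₀) (hB₀ : 0 ≤ θ.s2.lf.B₀)
    (hsel : θ.ppSel = ppSelLiveOfRecord F N θ.ν θ.τ9 (EOfRecord₁₃ F N θ) (wOfRecord₉ F N θ.toStage9Params)) {γ : ℝ} (hγ : 0 < γ)
    (hT : ∀ P : B12.RunParams, ((datumOfRecord₁₃ F N θ h).C P).flow.InInterval γ P.K → ∀ k, k < P.K → SLaw₁₃ F N θ P k →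
      ∃ (t : SeqOfRecord F θ.ν θ.τ9.M (gOfRecord₁₃ F N θ P) P.K (k + 1) → Sect2.TermValues (F.P P.K) (MatA N) (FluctV N) θ.τ9.M)
      (Ek : SeqOfRecord F θ.ν θ.τ9.M (gOfRecord₁₃ F N θ P) P.K (k + 1) → ℝ), Sect2.UniversalE t ∧
      ∀ s, Sect2.LawsT (sect2TowerOfRecord F N (FluctV N) P.K (settingOfRecord₁₃ F N θ P) (θ.Rz P.K) s (t s)) (settingOfRecord₁₃ F N θ P).lf
          (settingOfRecord₁₃ F N θ P).βc k ∧
        (LiveSeq F N θ.ν θ.τ9 P (gOfRecord₁₃ F N θ P) (k + 1)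
            (slotsTOfRecord F N θ.ν θ.τ9 (EOfRecord₁₃ F N θ) (wOfRecord₉ F N θ.toStage9Params) θ.ppSel P (gOfRecord₁₃ F N θ P) (k + 1)) s →
          (slotsTOfRecord F N θ.ν θ.τ9 (EOfRecord₁₃ F N θ) (wOfRecord₉ F N θ.toStage9Params) θ.ppSel P (gOfRecord₁₃ F N θ P) (k + 1) s = 0 ∨
            ∀ᵐ V ∂(fieldMeasure (F.P P.K) (k + 1) (SU N)), chiSeqOfRecord F N θ.ν θ.τ9.M (gOfRecord₁₃ F N θ P) P.K (k + 1) s V ≠ 0 →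
              slotsTOfRecord F N θ.ν θ.τ9 (EOfRecord₁₃ F N θ) (wOfRecord₉ F N θ.toStage9Params) θ.ppSel P (gOfRecord₁₃ F N θ P) (k + 1) s V
                = sect2Slot F N (FluctV N) P.K (settingOfRecord₁₃ F N θ P) (θ.Rz P.K) (WtOfRecord₁₃ F N θ P) s (t s) (Ek s)
                    (UbgOfRecord₁₃ F N θ P (k + 1) s) V))) :
    B16.Thm1Printed (datumOfRecord₁₃ F N θ h).C := by
  refine B16.thm1_of_steps _ γ hγ (inductionBase_datumOfRecord₁₃ F N θ h γ) fun P hP k hk hS => ?_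
  have hS' : SLaw₁₃ F N θ P k := (sLaw₁₃_iff F N θ P k).mpr ((sect2Form_stage13_iff F N θ h P k).mp hS)
  exact (sect2Form_stage13_iff F N θ h P (k + 1)).mpr ((sLaw₁₃_iff F N θ P (k + 1)).mp
    (sLaw₁₃_succ_of_tLawLiveSeq_of_liveSel F N θ P h hθ hκ hE₀ hB₀ hsel k hk (hT P hP k hk hS')))

/-- **★ AT THE LIVE SELECTOR, `ρ_{k+1} = 𝐓ρ_k` ALMOST EVERYWHERE**, `k < K`, Stage 13 — 𝐑 OF RECORD IS THE IDENTITY UP TO NULL SETS on the live line (from `Provisos₁₃`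
alone). [cite: Balaban1989LargeFieldI, (0.2)–(0.4) p.176, p.177 (i)–(ii); Balaban1988Convergent, (2.18) p.257, Thm 1 p.262, (3.24)–(3.25) p.270; Balaban1989LargeFieldII, Thm 1 p.355 (not exercised)] -/
theorem densOfRecord₁₃_succ_ae_eq_tdens_of_liveSel (hP : θ.Provisos₁₃ F N)
    (hsel : θ.ppSel = ppSelLiveOfRecord F N θ.ν θ.τ9 (EOfRecord₁₃ F N θ) (wOfRecord₉ F N θ.toStage9Params)) (k : ℕ) (hk : k < p.K) :
    densOfRecord₁₃ F N θ p (k + 1) =ᵐ[fieldMeasure (F.P p.K) (k + 1) (SU N)] tdensOfRecord₁₃ F N θ p k :=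
  densOfRecord₁₃_succ_ae_eq_tdens_of_idem_of_dead F N θ p hP k hk (ppSel_succ_idem_of_liveSel F N θ hsel p k)
    (fun a hne V => dead_of_ppSel_succ_ne_of_liveSel F N θ hsel p k a hne V)

end LiveSel

/-! ## §7  (v1.1) THE GENERAL-SELECTOR SOCKET PER PRESENT SEQUENCE at Stage 13 ([IV] Prop. 1 + [B16] (1.100)–(1.101) at the objects of record; off-range by §1) -/

section Socket

variable (θ : Stage13Params F N) (p : B12.RunParams)

/-- **`TLaw₁₃ k → SLaw₁₃ (k+1)` FROM THE ABSORPTION OF THE 𝐑-FACTOR AT THE PRESENT SEQUENCES** (general selector, Stage 13): if the witnesses `t, E_k` of the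
𝐓-image form of `𝐓ρ_k`'s slots (laws `LawsT … k` and, per sequence, «absent or the §2 identity a.e. on the support») can be RE-PRESENTED by term values `t′, E′` —
universal in 𝐄, obeying the inductive assumptions `LawsRT … (k+1)` at EVERY sequence — such that AT EVERY PRESENT SEQUENCE `s′ ∈ range (θ.ppSel p g (k+1))` the
post-𝐑 slot `slot_{k+1}(s′)` is absent or equals `𝐓_{k+1}(s′) e^{A(t′ s′)}` a.e. on the `χ_{k+1}(s′)`-support (the 𝐑-factor absorbed into new terms), then
`SLaw₁₃ θ p (k+1)` — the OFF-RANGE sequences being absent from `ρ_{k+1}` by §1.  The displayed hypothesis is [IV] Prop. 1 (1.1)–(1.2) with [B16] (1.100)–(1.101)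
READ AT THE STAGE-13 OBJECTS OF RECORD (not in the tree at the record; NOT asserted). [cite: Balaban1989LargeFieldI, Prop. 1 (1.1)–(1.2) p.177, (0.3) p.176; Balaban1989LargeFieldII, Thm 1 p.355, (1.100)–(1.101) pp.390–391; Balaban1988Convergent, Thm 2 p.263] -/
theorem sLaw₁₃_succ_of_tLaw₁₃_of_absorbPresent (k : ℕ) (hT : TLaw₁₃ F N θ p k)
    (habs : ∀ (t : SeqOfRecord F θ.ν θ.τ9.M (gOfRecord₁₃ F N θ p) p.K (k + 1) → Sect2.TermValues (F.P p.K) (MatA N) (FluctV N) θ.τ9.M)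
      (Ek : SeqOfRecord F θ.ν θ.τ9.M (gOfRecord₁₃ F N θ p) p.K (k + 1) → ℝ), Sect2.UniversalE t →
      (∀ s, Sect2.LawsT (sect2TowerOfRecord F N (FluctV N) p.K (settingOfRecord₁₃ F N θ p) (θ.Rz p.K) s (t s)) (settingOfRecord₁₃ F N θ p).lf
          (settingOfRecord₁₃ F N θ p).βc k ∧
        (slotsTOfRecord F N θ.ν θ.τ9 (EOfRecord₁₃ F N θ) (wOfRecord₉ F N θ.toStage9Params) θ.ppSel p (gOfRecord₁₃ F N θ p) (k + 1) s = 0 ∨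
          ∀ᵐ V ∂(fieldMeasure (F.P p.K) (k + 1) (SU N)), chiSeqOfRecord F N θ.ν θ.τ9.M (gOfRecord₁₃ F N θ p) p.K (k + 1) s V ≠ 0 →
            slotsTOfRecord F N θ.ν θ.τ9 (EOfRecord₁₃ F N θ) (wOfRecord₉ F N θ.toStage9Params) θ.ppSel p (gOfRecord₁₃ F N θ p) (k + 1) s V
              = sect2Slot F N (FluctV N) p.K (settingOfRecord₁₃ F N θ p) (θ.Rz p.K) (WtOfRecord₁₃ F N θ p) s (t s) (Ek s)
                  (UbgOfRecord₁₃ F N θ p (k + 1) s) V)) →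
      ∃ (t' : SeqOfRecord F θ.ν θ.τ9.M (gOfRecord₁₃ F N θ p) p.K (k + 1) → Sect2.TermValues (F.P p.K) (MatA N) (FluctV N) θ.τ9.M)
        (Ek' : SeqOfRecord F θ.ν θ.τ9.M (gOfRecord₁₃ F N θ p) p.K (k + 1) → ℝ), Sect2.UniversalE t' ∧
        (∀ s, Sect2.LawsRT (sect2TowerOfRecord F N (FluctV N) p.K (settingOfRecord₁₃ F N θ p) (θ.Rz p.K) s (t' s)) (settingOfRecord₁₃ F N θ p).lf
            (k + 1)) ∧
        ∀ s, s ∈ Set.range (θ.ppSel p (gOfRecord₁₃ F N θ p) (k + 1)) →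
          (slotsOfRecord F N θ.ν θ.τ9 (EOfRecord₁₃ F N θ) (wOfRecord₉ F N θ.toStage9Params) θ.ppSel p (gOfRecord₁₃ F N θ p) (k + 1) s = 0 ∨
            ∀ᵐ V ∂(fieldMeasure (F.P p.K) (k + 1) (SU N)), chiSeqOfRecord F N θ.ν θ.τ9.M (gOfRecord₁₃ F N θ p) p.K (k + 1) s V ≠ 0 →
              slotsOfRecord F N θ.ν θ.τ9 (EOfRecord₁₃ F N θ) (wOfRecord₉ F N θ.toStage9Params) θ.ppSel p (gOfRecord₁₃ F N θ p) (k + 1) s V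
                = sect2Slot F N (FluctV N) p.K (settingOfRecord₁₃ F N θ p) (θ.Rz p.K) (WtOfRecord₁₃ F N θ p) s (t' s) (Ek' s)
                    (UbgOfRecord₁₃ F N θ p (k + 1) s) V)) :
    SLaw₁₃ F N θ p (k + 1) := by
  rw [sLaw₁₃_iff]
  obtain ⟨t, Ek, hu, hs⟩ := (tLaw₁₃_iff F N θ p k).mp hT
  obtain ⟨t', Ek', hu', hl', hs'⟩ := habs t Ek hu hs
  refine ⟨t', Ek', hu', fun s => ⟨hl' s, ?_⟩⟩
  by_cases hmem : s ∈ Set.range (θ.ppSel p (gOfRecord₁₃ F N θ p) (k + 1))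
  · exact hs' s hmem
  · exact Or.inl (slotsOfRecord₁₃_succ_eq_zero_of_not_mem_range F N θ p k s hmem)

/-- **THE GENERAL-SELECTOR SOCKET FOR THE STAGE-13 LEAF**: the present-sequence absorption hypothesis of `sLaw₁₃_succ_of_tLaw₁₃_of_absorbPresent` at every level `k < K`
gives `ROpLeaf (VOfRecord₁₃ F N θ p)` — the DISCHARGE-SHAPED statement of the 𝐑-half of N13 at the Stage-13 record: its one displayed hypothesis is [B16] Theorem 1's
𝐑-construction read at the objects of record, asked ONLY where print's 𝐑 acts (NOT asserted; the estimate a K1‴ witness with a genuine 𝐑 would owe).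
[cite: Balaban1989LargeFieldII, Thm 1 p.355, (1.100)–(1.101) pp.390–391; Balaban1989LargeFieldI, Prop. 1 (1.1)–(1.2) p.177; Balaban1988Convergent, p.244, Thm 2 p.263] -/
theorem rOpLeaf_VOfRecord₁₃_of_absorbPresent
    (habs : ∀ k, k < p.K →
      ∀ (t : SeqOfRecord F θ.ν θ.τ9.M (gOfRecord₁₃ F N θ p) p.K (k + 1) → Sect2.TermValues (F.P p.K) (MatA N) (FluctV N) θ.τ9.M)
      (Ek : SeqOfRecord F θ.ν θ.τ9.M (gOfRecord₁₃ F N θ p) p.K (k + 1) → ℝ), Sect2.UniversalE t →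
      (∀ s, Sect2.LawsT (sect2TowerOfRecord F N (FluctV N) p.K (settingOfRecord₁₃ F N θ p) (θ.Rz p.K) s (t s)) (settingOfRecord₁₃ F N θ p).lf
          (settingOfRecord₁₃ F N θ p).βc k ∧
        (slotsTOfRecord F N θ.ν θ.τ9 (EOfRecord₁₃ F N θ) (wOfRecord₉ F N θ.toStage9Params) θ.ppSel p (gOfRecord₁₃ F N θ p) (k + 1) s = 0 ∨
          ∀ᵐ V ∂(fieldMeasure (F.P p.K) (k + 1) (SU N)), chiSeqOfRecord F N θ.ν θ.τ9.M (gOfRecord₁₃ F N θ p) p.K (k + 1) s V ≠ 0 →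
            slotsTOfRecord F N θ.ν θ.τ9 (EOfRecord₁₃ F N θ) (wOfRecord₉ F N θ.toStage9Params) θ.ppSel p (gOfRecord₁₃ F N θ p) (k + 1) s V
              = sect2Slot F N (FluctV N) p.K (settingOfRecord₁₃ F N θ p) (θ.Rz p.K) (WtOfRecord₁₃ F N θ p) s (t s) (Ek s)
                  (UbgOfRecord₁₃ F N θ p (k + 1) s) V)) →
      ∃ (t' : SeqOfRecord F θ.ν θ.τ9.M (gOfRecord₁₃ F N θ p) p.K (k + 1) → Sect2.TermValues (F.P p.K) (MatA N) (FluctV N) θ.τ9.M)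
        (Ek' : SeqOfRecord F θ.ν θ.τ9.M (gOfRecord₁₃ F N θ p) p.K (k + 1) → ℝ), Sect2.UniversalE t' ∧
        (∀ s, Sect2.LawsRT (sect2TowerOfRecord F N (FluctV N) p.K (settingOfRecord₁₃ F N θ p) (θ.Rz p.K) s (t' s)) (settingOfRecord₁₃ F N θ p).lf
            (k + 1)) ∧
        ∀ s, s ∈ Set.range (θ.ppSel p (gOfRecord₁₃ F N θ p) (k + 1)) →
          (slotsOfRecord F N θ.ν θ.τ9 (EOfRecord₁₃ F N θ) (wOfRecord₉ F N θ.toStage9Params) θ.ppSel p (gOfRecord₁₃ F N θ p) (k + 1) s = 0 ∨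
            ∀ᵐ V ∂(fieldMeasure (F.P p.K) (k + 1) (SU N)), chiSeqOfRecord F N θ.ν θ.τ9.M (gOfRecord₁₃ F N θ p) p.K (k + 1) s V ≠ 0 →
              slotsOfRecord F N θ.ν θ.τ9 (EOfRecord₁₃ F N θ) (wOfRecord₉ F N θ.toStage9Params) θ.ppSel p (gOfRecord₁₃ F N θ p) (k + 1) s V
                = sect2Slot F N (FluctV N) p.K (settingOfRecord₁₃ F N θ p) (θ.Rz p.K) (WtOfRecord₁₃ F N θ p) s (t' s) (Ek' s)
                    (UbgOfRecord₁₃ F N θ p (k + 1) s) V)) :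
    ROpLeaf (VOfRecord₁₃ F N θ p) := by
  rw [rOpLeaf_VOfRecord₁₃_iff]
  intro k hk hT
  exact sLaw₁₃_succ_of_tLaw₁₃_of_absorbPresent F N θ p k hT (habs k hk)

/-- **The general-selector socket IN LAW FORM** (the (R₁₃) slot for a witness with a genuine 𝐑). [cite: Balaban1989LargeFieldII, Thm 1 p.355, (1.100)–(1.101) pp.390–391; Balaban1988Convergent, p.244 (bookkeeping)] -/
theorem laws₁₃_of_absorbPresent
    (habs : ∀ k, k < p.K →
      ∀ (t : SeqOfRecord F θ.ν θ.τ9.M (gOfRecord₁₃ F N θ p) p.K (k + 1) → Sect2.TermValues (F.P p.K) (MatA N) (FluctV N) θ.τ9.M)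
      (Ek : SeqOfRecord F θ.ν θ.τ9.M (gOfRecord₁₃ F N θ p) p.K (k + 1) → ℝ), Sect2.UniversalE t →
      (∀ s, Sect2.LawsT (sect2TowerOfRecord F N (FluctV N) p.K (settingOfRecord₁₃ F N θ p) (θ.Rz p.K) s (t s)) (settingOfRecord₁₃ F N θ p).lf
          (settingOfRecord₁₃ F N θ p).βc k ∧
        (slotsTOfRecord F N θ.ν θ.τ9 (EOfRecord₁₃ F N θ) (wOfRecord₉ F N θ.toStage9Params) θ.ppSel p (gOfRecord₁₃ F N θ p) (k + 1) s = 0 ∨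
          ∀ᵐ V ∂(fieldMeasure (F.P p.K) (k + 1) (SU N)), chiSeqOfRecord F N θ.ν θ.τ9.M (gOfRecord₁₃ F N θ p) p.K (k + 1) s V ≠ 0 →
            slotsTOfRecord F N θ.ν θ.τ9 (EOfRecord₁₃ F N θ) (wOfRecord₉ F N θ.toStage9Params) θ.ppSel p (gOfRecord₁₃ F N θ p) (k + 1) s V
              = sect2Slot F N (FluctV N) p.K (settingOfRecord₁₃ F N θ p) (θ.Rz p.K) (WtOfRecord₁₃ F N θ p) s (t s) (Ek s)
                  (UbgOfRecord₁₃ F N θ p (k + 1) s) V)) →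
      ∃ (t' : SeqOfRecord F θ.ν θ.τ9.M (gOfRecord₁₃ F N θ p) p.K (k + 1) → Sect2.TermValues (F.P p.K) (MatA N) (FluctV N) θ.τ9.M)
        (Ek' : SeqOfRecord F θ.ν θ.τ9.M (gOfRecord₁₃ F N θ p) p.K (k + 1) → ℝ), Sect2.UniversalE t' ∧
        (∀ s, Sect2.LawsRT (sect2TowerOfRecord F N (FluctV N) p.K (settingOfRecord₁₃ F N θ p) (θ.Rz p.K) s (t' s)) (settingOfRecord₁₃ F N θ p).lf
            (k + 1)) ∧
        ∀ s, s ∈ Set.range (θ.ppSel p (gOfRecord₁₃ F N θ p) (k + 1)) →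
          (slotsOfRecord F N θ.ν θ.τ9 (EOfRecord₁₃ F N θ) (wOfRecord₉ F N θ.toStage9Params) θ.ppSel p (gOfRecord₁₃ F N θ p) (k + 1) s = 0 ∨
            ∀ᵐ V ∂(fieldMeasure (F.P p.K) (k + 1) (SU N)), chiSeqOfRecord F N θ.ν θ.τ9.M (gOfRecord₁₃ F N θ p) p.K (k + 1) s V ≠ 0 →
              slotsOfRecord F N θ.ν θ.τ9 (EOfRecord₁₃ F N θ) (wOfRecord₉ F N θ.toStage9Params) θ.ppSel p (gOfRecord₁₃ F N θ p) (k + 1) s V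
                = sect2Slot F N (FluctV N) p.K (settingOfRecord₁₃ F N θ p) (θ.Rz p.K) (WtOfRecord₁₃ F N θ p) s (t' s) (Ek' s)
                    (UbgOfRecord₁₃ F N θ p (k + 1) s) V)) :
    ∀ k, k < p.K → TLaw₁₃ F N θ p k → SLaw₁₃ F N θ p (k + 1) :=
  (rOpLeaf_VOfRecord₁₃_iff F N θ p).mp (rOpLeaf_VOfRecord₁₃_of_absorbPresent F N θ p habs)

end Socket

end Literature.MathematicalPhysics.QuantumFieldTheory.Balaban1983to89.B16RLeafRecord13Live

end
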